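import Literature.Analysis.FluidPDE.QuasiSelfSimilarGeneratorPhases
import Literature.Analysis.FluidPDE.QuasiSelfSimilarFamilyEstimates
import Literature.Analysis.FluidPDE.SmoothRampProfiles
import Literature.Analysis.FunctionSpaces.TorusPatchingGlue
import HarnessLib

/-!
# The cellwise stage of a generator move (Alberti–Crippa–Mazzucato 2019, §8.10–8.11:
"we modify `Γ(1/2)` within each square of `𝒯_{1/5}` using one of the moves of Fig. 11")

Topic `Literature/Analysis/FluidPDE`. Infrastructure towards the discharge of the kinematic leaf
`Literature.Analysis.FluidPDE.acm_compatible_blocks` (`QuasiSelfSimilarCompatibleBlocks.lean`),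
consumer end (companion of `QuasiSelfSimilarGenerators.lean`, `…GeneratorMoves.lean`,
`…GeneratorPhases.lean`). In ACM's construction of the two generating moves (§8.10 for `Γ₁`,
§8.11 for `Γ₂`, Figs. 10–12) the second half `[1/2, 1]` of each move is **cellwise**: at
`t = 1/2` the channel is a snake of plain pieces through the `25` squares of `𝒯_{1/5}`, crossing
every interface orthogonally at its midpoint, and during `[1/2, 1]` each square is modified
independently by one of two "fine moves" (Fig. 11), all squares agreeing near the crossed
interfaces with one and the same thinning field of a straight channel. This file proves the
abstract gluing statement that turns `25` such cell moves into ONE phase of a generator move on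
the unit square, in the format `QuasiSelfSimilar.IsGeneratorMoveOn` of
`QuasiSelfSimilarGeneratorPhases.lean` (to be time-glued with the first half by
`IsGeneratorMoveOn.glue_Icc`):

* `QuasiSelfSimilar.IsCellFamily S Vc Θc gate Wv Wθ δ` — the hypotheses: `25` pairs of smooth
  fields `(Vc p, Θc p)` on `ℝ × ℝ²` (cell `p ∈ {0,…,4}²`, each in the coordinates of its own unit
  square), divergence free / transporting / bounded by `10` on `S × [0,1]²`; LITERAL agreement of
  horizontally or vertically adjacent cells on the `δ`-strip around the common side (at all
  times, in the chart of the upper cell: `F_{p+e_k}(t, z) = F_p(t, z + e_k)` for `|z_k| < δ`,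
  `z ∈ (-δ, 1+δ)²`); on the `δ`-strips around the OUTER sides, the cell fields vanish, except the
  two middle cells of the gate sides of the big square, which there equal the window fields
  `(Wv k, Wθ k)(t, z - faceMidpoint k s)`; the window fields are smooth, tangent to the face and
  vanish at transversal offset `≥ δ`. Nothing is assumed about HOW the cells agree (thinning,
  sliding of material and the flank circulation that carries area between paired cells across
  the interior interfaces are the designer's business: the interior interfaces are not walls).
* `QuasiSelfSimilar.cellwiseV`, `QuasiSelfSimilar.cellwiseΘ` — the glued fields on `ℝ × ℝ²`:
  `Torus.patch 5` of the rescaled cell fields (`5⁻¹ • Vc p (5y - p)`, `Θc p (5y - p)` on the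
  cell `p/5 + [0,1/5)²`) inside `[0,1)²`, and of an explicit exterior field (the two window
  fields placed at the outer gates, cut off in the normal variable) outside;
* `IsCellFamily.isGeneratorMoveOn` — the conclusion: `IsGeneratorMoveOn S cellwiseV cellwiseΘ
  gate Vg Θg (δ/5)` with the gate fields `Vg k t ξ = 5⁻¹ • Wv k t (5 • ξ)`,
  `Θg k t ξ = Wθ k t (5 • ξ)`; and the cell formulas `cellwiseΘ_apply_of_mem_latticeCell`,
  `cellwiseV_apply_of_mem_latticeCell` (on the half-open cells, interfaces included), from which
  the end states of the phase are read off cell by cell (at `t = 1`: the self-similarity clause,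
  by construction of the fine moves; at `t = 1/2`: the junction with the first half);
* `QuasiSelfSimilar.IsCellMove` and `IsCellFamily.of_moves` — the form in which a design delivers
  the family: one move per cell with its own gates and its own window fields at the four faces
  (the clauses of `IsGeneratorMoveOn` without tangency), equal gate status and equal window fields
  across every interior interface, the universal window fields at the outer gates;
* `SquareSymm.isCellMove_act` — a cell move placed by one of the eight symmetries of the square
  is a cell move (moved gates `actGate`, moved window fields `actWv`/`actWθ`), so that one design
  per fine move serves all orientations (`QuasiSelfSimilarSymmetry.lean`);
* `IsCellMove.add_velocity` — stability under adding a smooth incompressible field `Z` with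
  `DΘ[Z] = 0` (material sliding through the cell and the flank circulation between paired cells,
  which differ from cell to cell along the snake, ACM §8.11 "suitably synchronized").

The smoothness of the glued fields is the local form of `FunctionSpaces.Torus.PatchCompatible`
(`PatchCompatibleNear`: agreement is only required for block coordinates in `(-δ, 1+δ)^d`, which
is all the proof of `Torus.contDiff_uncurry_patch_of_compatible` uses); the differential clauses
transfer through the germ formula on the half-open cells and extend to the closed square by
continuity; the boundary clauses are read off the values.

## References

* G. Alberti, G. Crippa, A. L. Mazzucato, *Exponential self-similar mixing by incompressible
  flows*, J. Amer. Math. Soc. 32 (2019), 445–490, §8.4 (a)–(c), §8.6, §8.10–8.11, Figs. 10–12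
  (arXiv:1605.02090).
* E. Bruè, C. De Lellis, *Anomalous dissipation for the forced 3D Navier–Stokes equations*,
  Comm. Math. Phys. 400 (2023), 1507–1533, §4.1.
-/

noncomputable section

open Set Filter Function MeasureTheory

open scoped Topology ContDiff

namespace Literature.Analysis.FluidPDE

namespace QuasiSelfSimilar

open FunctionSpaces FunctionSpaces.Torus

/-! ## Local compatibility of patched blocks -/

section PatchNear

variable {d : Type*} [Fintype d] [DecidableEq d] {I : Type*}
  {X : Type*} [NormedAddCommGroup X] [NormedSpace ℝ X]

/-- **Local compatibility of blocks** placed by the labels `ι` on the cells of mesh `m⁻¹`: the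
condition `FunctionSpaces.Torus.PatchCompatible` (adjacent blocks agree, in the chart of the upper
cell, on the `δ`-strip around the common face / corner) required only for block coordinates in
the box `(-δ, 1+δ)^d` — the only ones at which a block is ever compared with the patched
function. [cite: AlbertiCrippaMazzucato2019, §8.6] -/
def PatchCompatibleNear (ι : (d → ℤ) → I) (G : I → ℝ → EuclideanSpace ℝ d → X) (δ : ℝ) : Prop :=
  ∀ (κ e : d → ℤ), (∀ i, e i = 0 ∨ e i = 1) → ∀ (t : ℝ) (z : EuclideanSpace ℝ d),
    (∀ i, -δ < z i ∧ z i < 1 + δ) → (∀ i, e i = 1 → |z i| < δ) →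
      G (ι κ) t z = G (ι (κ - e)) t (z + latticeVec e)

variable {m : ℕ} {ι : (d → ℤ) → I} {G : I → ℝ → EuclideanSpace ℝ d → X} {δ : ℝ}

omit [NormedAddCommGroup X] [NormedSpace ℝ X] in
/-- **The patched function near a point is one rescaled block**, under local compatibility
(`δ > 0`, `m ≥ 1`): around every `(t₀, y₀)`, `y₀ ∈ Q_{κ₀}`, the space–time patched function
`(t, y) ↦ patch m ι (G · t) y` coincides with `(t, y) ↦ G_{ι κ₀}(t, m y - κ₀)` (the proof of
`Torus.patch_eventuallyEq_block_of_compatible`, which only compares blocks at coordinates in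
`(-δ, 1]^d`). [folklore] -/
theorem patch_eventuallyEq_block_of_compatibleNear (hm : 0 < m) (hδ : 0 < δ)
    (hc : PatchCompatibleNear ι G δ) (t₀ : ℝ) (y₀ : EuclideanSpace ℝ d) :
    (fun p : ℝ × EuclideanSpace ℝ d => patch m ι (fun l => G l p.1) p.2) =ᶠ[𝓝 (t₀, y₀)]
      fun p => G (ι (cellIndex m y₀)) p.1 ((m : ℝ) • p.2 - latticeVec (cellIndex m y₀)) := by
  set κ₀ := cellIndex m y₀ with hκ₀
  have hm' : (0 : ℝ) < m := by exact_mod_cast hm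
  set δ' : ℝ := min δ 1 with hδ'
  have hδ'pos : 0 < δ' := lt_min hδ one_pos
  have hδ'le : δ' ≤ δ := min_le_left _ _
  have hδ'le1 : δ' ≤ 1 := min_le_right _ _
  have hy₀ := mem_latticeCell_cellIndex hm y₀
  have hcont : ∀ i, Continuous fun p : ℝ × EuclideanSpace ℝ d => (m : ℝ) * p.2 i := fun i =>
    continuous_const.mul ((PiLp.continuous_apply 2 (fun _ : d => ℝ) i).comp continuous_snd)
  have hev : ∀ᶠ p : ℝ × EuclideanSpace ℝ d in 𝓝 (t₀, y₀),
      ∀ i, (m : ℝ) * p.2 i < κ₀ i + 1 ∧ (κ₀ i : ℝ) - δ' < (m : ℝ) * p.2 i := by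
    refine eventually_all.2 fun i => ?_
    have h1 : (m : ℝ) * y₀ i < κ₀ i + 1 := by
      have := (hy₀ i).2
      rw [lt_div_iff₀ hm'] at this
      linarith
    have h2 : (κ₀ i : ℝ) - δ' < (m : ℝ) * y₀ i := by
      have := (hy₀ i).1
      rw [div_le_iff₀ hm'] at this
      linarith
    exact ((hcont i).continuousAt.eventually_lt continuousAt_const h1).and
      (continuousAt_const.eventually_lt (hcont i).continuousAt h2)
  filter_upwards [hev] with p hp
  obtain ⟨t, y⟩ := p
  set κ := cellIndex m y with hκ
  set e : d → ℤ := κ₀ - κ with he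
  have hκi : ∀ i, κ i = ⌊(m : ℝ) * y i⌋ := fun i => rfl
  have he01 : ∀ i, e i = 0 ∨ e i = 1 := by
    intro i
    obtain ⟨ha, hb⟩ := hp i
    have hle : κ i ≤ κ₀ i := by
      rw [hκi, Int.floor_le_iff]; exact_mod_cast ha
    have hge : κ₀ i - 1 ≤ κ i := by
      rw [hκi, Int.le_floor]; push_cast; linarith
    have : e i = κ₀ i - κ i := rfl
    omega
  have hrange : ∀ i, -δ < ((m : ℝ) • y - latticeVec κ₀) i ∧ ((m : ℝ) • y - latticeVec κ₀) i < 1 + δ := by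
    intro i
    obtain ⟨ha, hb⟩ := hp i
    rw [PiLp.sub_apply, PiLp.smul_apply, smul_eq_mul, latticeVec_apply]
    constructor <;> linarith
  have hstrip : ∀ i, e i = 1 → |((m : ℝ) • y - latticeVec κ₀) i| < δ := by
    intro i hi
    obtain ⟨ha, hb⟩ := hp i
    have hki : κ i = κ₀ i - 1 := by have : e i = κ₀ i - κ i := rfl; omega
    have hlt : (m : ℝ) * y i < κ₀ i := by
      have := Int.lt_floor_add_one ((m : ℝ) * y i)
      rw [← hκi, hki] at this
      push_cast at this
      linarith
    rw [PiLp.sub_apply, PiLp.smul_apply, smul_eq_mul, latticeVec_apply, abs_lt]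
    constructor <;> linarith
  have hκe : κ₀ - e = κ := by simp [he]
  have key := hc κ₀ e he01 t ((m : ℝ) • y - latticeVec κ₀) hrange hstrip
  rw [hκe] at key
  have hvec : (m : ℝ) • y - latticeVec κ₀ + latticeVec e = (m : ℝ) • y - latticeVec κ := by
    rw [← hκe]
    ext i
    simp only [PiLp.add_apply, PiLp.sub_apply, latticeVec_apply, Pi.sub_apply, Int.cast_sub]
    ring
  rw [hvec] at key
  show patch m ι (fun l => G l t) y = G (ι κ₀) t ((m : ℝ) • y - latticeVec κ₀)
  rw [key, patch_apply]
  rfl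

/-- **Smooth gluing of locally compatible blocks**: if the blocks `G_l(t, z)` are jointly `Cⁿ`
and locally compatible across the interfaces (`PatchCompatibleNear ι G δ`, `δ > 0`), the patched
space–time function `(t, y) ↦ patch m ι (G · t) y` is `Cⁿ` on `ℝ × ℝ^d` (`m ≥ 1`). [cite: AlbertiCrippaMazzucato2019, §6.3 and §8.6] -/
theorem contDiff_uncurry_patch_of_compatibleNear (hm : 0 < m) {n : WithTop ℕ∞}
    (hG : ∀ l, ContDiff ℝ n (uncurry (G l))) (hδ : 0 < δ) (hc : PatchCompatibleNear ι G δ) :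
    ContDiff ℝ n fun p : ℝ × EuclideanSpace ℝ d => patch m ι (fun l => G l p.1) p.2 := by
  refine contDiff_iff_contDiffAt.2 fun p₀ => ?_
  obtain ⟨t₀, y₀⟩ := p₀
  have hblock : ContDiff ℝ n fun p : ℝ × EuclideanSpace ℝ d =>
      G (ι (cellIndex m y₀)) p.1 ((m : ℝ) • p.2 - latticeVec (cellIndex m y₀)) :=
    (hG _).comp (contDiff_fst.prodMk ((contDiff_snd.const_smul (m : ℝ)).sub contDiff_const))
  exact hblock.contDiffAt.congr_of_eventuallyEq
    (patch_eventuallyEq_block_of_compatibleNear hm hδ hc t₀ y₀)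

omit [NormedAddCommGroup X] [NormedSpace ℝ X] in
/-- Under local compatibility, the time line of the patched function through any point `y₀` is
the time line of the block of the cell of `y₀` (values, all times). [folklore] -/
theorem patch_line_eq (hm : 0 < m) (t : ℝ) (y₀ : EuclideanSpace ℝ d) :
    patch m ι (fun l => G l t) y₀ =
      G (ι (cellIndex m y₀)) t ((m : ℝ) • y₀ - latticeVec (cellIndex m y₀)) :=
  patch_apply_of_mem_latticeCell hm (mem_latticeCell_cellIndex hm y₀)

omit [NormedAddCommGroup X] [NormedSpace ℝ X] in
/-- Under local compatibility, the space slice of the patched function at time `t` agrees near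
`y₀` with the slice of the block of the cell of `y₀`. [folklore] -/
theorem patch_slice_eventuallyEq (hm : 0 < m) (hδ : 0 < δ) (hc : PatchCompatibleNear ι G δ)
    (t : ℝ) (y₀ : EuclideanSpace ℝ d) :
    (patch m ι fun l => G l t) =ᶠ[𝓝 y₀]
      fun y => G (ι (cellIndex m y₀)) t ((m : ℝ) • y - latticeVec (cellIndex m y₀)) := by
  have h := patch_eventuallyEq_block_of_compatibleNear hm hδ hc t y₀
  have hcts : ContinuousAt (fun y : EuclideanSpace ℝ d => ((t, y) : ℝ × EuclideanSpace ℝ d)) y₀ :=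
    (Continuous.prodMk_right t).continuousAt
  exact hcts.eventually h

end PatchNear

/-! ## Cells of `𝒯_{1/5}` -/

/-- The plane. [folklore] -/
local notation "E²" => EuclideanSpace ℝ (Fin 2)

/-- The integer index of the cell at position `p ∈ {0,…,4}²`. [folklore] -/
def cidx (p : Fin 2 → Fin 5) : Fin 2 → ℤ := fun k => ((p k : ℕ) : ℤ)

/-- Coordinates of `cidx`. [folklore] -/
@[simp] theorem cidx_apply (p : Fin 2 → Fin 5) (k : Fin 2) : cidx p k = ((p k : ℕ) : ℤ) := rfl

/-- An integer pair indexes one of the `25` cells of `𝒯_{1/5}` inside `[0,1)²`. [folklore] -/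
def IsInner (κ : Fin 2 → ℤ) : Prop := ∀ k, 0 ≤ κ k ∧ κ k < 5

/-- `IsInner` is decidable. [folklore] -/
instance (κ : Fin 2 → ℤ) : Decidable (IsInner κ) := by unfold IsInner; infer_instance

/-- The cell position of an inner integer index (junk outside). [folklore] -/
def toCell (κ : Fin 2 → ℤ) : Fin 2 → Fin 5 := fun k => ⟨(κ k).toNat % 5, Nat.mod_lt _ (by norm_num)⟩

/-- `cidx p` is inner. [folklore] -/
theorem isInner_cidx (p : Fin 2 → Fin 5) : IsInner (cidx p) := fun k =>
  ⟨by simp, by rw [cidx_apply]; exact_mod_cast (p k).isLt⟩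

/-- `toCell ∘ cidx = id`. [folklore] -/
@[simp] theorem toCell_cidx (p : Fin 2 → Fin 5) : toCell (cidx p) = p := by
  funext k
  apply Fin.ext
  simp [toCell, Nat.mod_eq_of_lt (p k).isLt]

/-- `cidx ∘ toCell = id` on inner indices. [folklore] -/
theorem cidx_toCell {κ : Fin 2 → ℤ} (h : IsInner κ) : cidx (toCell κ) = κ := by
  funext k
  obtain ⟨h0, h5⟩ := h k
  have h1 : ((κ k).toNat : ℤ) = κ k := Int.toNat_of_nonneg h0
  have h2 : (κ k).toNat < 5 := by omega
  simp [toCell, Nat.mod_eq_of_lt h2, h1]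

/-- Coordinates of `toCell` on inner indices. [folklore] -/
theorem natCast_toCell {κ : Fin 2 → ℤ} (h : IsInner κ) (k : Fin 2) : ((toCell κ k : ℕ) : ℤ) = κ k := by
  have := congrFun (cidx_toCell h) k
  simpa using this

/-- A point lies in `[0,1)²` iff its cell index at mesh `1/5` is inner. [folklore] -/
theorem isInner_cellIndex_iff (y : E²) : IsInner (cellIndex 5 y) ↔ y ∈ unitCube (Fin 2) := by
  simp only [IsInner, cellIndex_apply, mem_unitCube, mem_Ico, Nat.cast_ofNat]
  refine forall_congr' fun k => ?_
  rw [Int.floor_nonneg, Int.floor_lt]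
  push_cast
  constructor
  · rintro ⟨h1, h2⟩; constructor <;> nlinarith
  · rintro ⟨h1, h2⟩; constructor <;> nlinarith

/-- In `[0,1)²`, the point lies in the half-open cell of its (inner) cell index. [folklore] -/
theorem mem_latticeCell_cidx_toCell {y : E²} (hy : y ∈ unitCube (Fin 2)) :
    y ∈ latticeCell 5 (cidx (toCell (cellIndex 5 y))) := by
  rw [cidx_toCell ((isInner_cellIndex_iff y).2 hy)]
  exact mem_latticeCell_cellIndex (by norm_num) y

/-- The closed square lies in the closure of the half-open one. [folklore] -/
theorem closedSquare_subset_closure_unitCube : closedSquare ⊆ closure (unitCube (Fin 2)) := by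
  intro y hy
  rw [Metric.mem_closure_iff]
  intro ε hε
  -- shrink `y` towards the origin
  obtain ⟨r, hr0, hr1, hrε⟩ : ∃ r : ℝ, 0 < r ∧ r < 1 ∧ 2 * (1 - r) < ε := by
    refine ⟨max (1 / 2) (1 - ε / 4), ?_, ?_, ?_⟩
    · exact lt_max_of_lt_left (by norm_num)
    · exact max_lt (by norm_num) (by linarith)
    · have : 1 - ε / 4 ≤ max (1 / 2) (1 - ε / 4) := le_max_right _ _
      linarith
  refine ⟨r • y, fun k => ?_, ?_⟩
  · obtain ⟨h0, h1⟩ := hy k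
    rw [PiLp.smul_apply, smul_eq_mul]
    exact ⟨mul_nonneg hr0.le h0, by nlinarith⟩
  · rw [EuclideanSpace.dist_eq]
    have hk : ∀ k, dist (y k) ((r • y) k) ^ 2 ≤ (1 - r) ^ 2 := by
      intro k
      obtain ⟨h0, h1⟩ := hy k
      rw [Real.dist_eq, sq_abs, PiLp.smul_apply, smul_eq_mul]
      have : y k - r * y k = (1 - r) * y k := by ring
      rw [this, mul_pow]
      have hy2 : y k ^ 2 ≤ 1 := by nlinarith
      nlinarith [sq_nonneg (1 - r)]
    calc Real.sqrt (∑ k, dist (y k) ((r • y) k) ^ 2)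
        ≤ Real.sqrt (∑ _k : Fin 2, (1 - r) ^ 2) := Real.sqrt_le_sqrt (Finset.sum_le_sum fun k _ => hk k)
      _ = Real.sqrt (2 * (1 - r) ^ 2) := by simp
      _ ≤ Real.sqrt ((2 * (1 - r)) ^ 2) := Real.sqrt_le_sqrt (by nlinarith)
      _ = 2 * (1 - r) := Real.sqrt_sq (by linarith)
      _ < ε := hrε

/-! ## Cell families -/

/-- **A family of cell moves** for the cellwise stage of a generator move (ACM 2019, §8.10–8.11,
Fig. 11: the fine moves in the `25` squares of `𝒯_{1/5}`), relative to a time set `S`, the gates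
`gate` of the big square, window fields `(Wv k, Wθ k)` (one per axis, in cell scale, functions
of the offset from the face midpoint) and a cell-scale margin `δ`:
* every cell field is smooth on `ℝ × ℝ²`, and on `S × [0,1]²` (its own closed square)
  divergence free, transporting its scalar, with `|Θ| ≤ 10`;
* (interior interfaces) the fields of the cells `p` and `p + e_k` agree, in the chart of the
  upper cell, on the strip `|z_k| < δ` (block coordinates in `(-δ, 1+δ)²`), at all times;
* (outer sides) on the strip around an outer side a cell field vanishes, unless the side is a
  gate side of the big square and the cell is the middle cell of that side, where the field is
  the window field placed at the face midpoint;
* the window fields are smooth, tangent to their face, and vanish at transversal offset `≥ δ`.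
[cite: AlbertiCrippaMazzucato2019, §8.4 (a)–(c), §8.6, §8.10–8.11] -/
structure IsCellFamily (S : Set ℝ) (Vc : (Fin 2 → Fin 5) → ℝ → E² → E²)
    (Θc : (Fin 2 → Fin 5) → ℝ → E² → ℝ) (gate : Fin 2 → Bool → Bool)
    (Wv : Fin 2 → ℝ → E² → E²) (Wθ : Fin 2 → ℝ → E² → ℝ) (δ : ℝ) : Prop where
  /-- positive margin -/
  δ_pos : 0 < δ
  /-- small margin -/
  δ_le : δ ≤ 8⁻¹
  /-- cell velocities are smooth -/
  smooth_velocity : ∀ p, ContDiff ℝ ∞ (uncurry (Vc p))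
  /-- cell scalars are smooth -/
  smooth_scalar : ∀ p, ContDiff ℝ ∞ (uncurry (Θc p))
  /-- window velocities are smooth -/
  smooth_Wv : ∀ k, ContDiff ℝ ∞ (uncurry (Wv k))
  /-- window scalars are smooth -/
  smooth_Wθ : ∀ k, ContDiff ℝ ∞ (uncurry (Wθ k))
  /-- cellwise incompressibility on `S × [0,1]²` -/
  divFree : ∀ p, ∀ t ∈ S, ∀ z ∈ closedSquare, ∑ j, fderiv ℝ (Vc p t) z (EuclideanSpace.single j 1) j = 0
  /-- cellwise transport on `S × [0,1]²` -/
  transport : ∀ p, ∀ t ∈ S, ∀ z ∈ closedSquare,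
    deriv (fun s => Θc p s z) t + fderiv ℝ (Θc p t) z (Vc p t z) = 0
  /-- cellwise bound -/
  abs_le : ∀ p, ∀ t ∈ S, ∀ z ∈ closedSquare, |Θc p t z| ≤ 10
  /-- interior interfaces: the upper neighbour in direction `k` agrees with `p` on the strip -/
  compat : ∀ (p : Fin 2 → Fin 5) (k : Fin 2) (h : (p k : ℕ) + 1 < 5) (t : ℝ) (z : E²),
    (∀ i, -δ < z i ∧ z i < 1 + δ) → |z k| < δ →
      Vc (update p k ⟨(p k : ℕ) + 1, h⟩) t z = Vc p t (z + EuclideanSpace.single k 1) ∧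
        Θc (update p k ⟨(p k : ℕ) + 1, h⟩) t z = Θc p t (z + EuclideanSpace.single k 1)
  /-- outer lower sides, gate window of the middle cell -/
  outer_lo_gate : ∀ (p : Fin 2 → Fin 5) (k : Fin 2), (p k : ℕ) = 0 → gate k false = true →
    (∀ j, j ≠ k → (p j : ℕ) = 2) → ∀ (t : ℝ) (z : E²), (∀ i, -δ < z i ∧ z i < 1 + δ) → |z k| < δ →
      Vc p t z = Wv k t (z - faceMidpoint k false) ∧ Θc p t z = Wθ k t (z - faceMidpoint k false)
  /-- outer lower sides, elsewhere -/
  outer_lo_vanish : ∀ (p : Fin 2 → Fin 5) (k : Fin 2), (p k : ℕ) = 0 →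
    (¬ gate k false = true ∨ ∃ j, j ≠ k ∧ (p j : ℕ) ≠ 2) → ∀ (t : ℝ) (z : E²),
      (∀ i, -δ < z i ∧ z i < 1 + δ) → |z k| < δ → Vc p t z = 0 ∧ Θc p t z = 0
  /-- outer upper sides, gate window of the middle cell -/
  outer_hi_gate : ∀ (p : Fin 2 → Fin 5) (k : Fin 2), (p k : ℕ) = 4 → gate k true = true →
    (∀ j, j ≠ k → (p j : ℕ) = 2) → ∀ (t : ℝ) (z : E²), (∀ i, -δ < z i ∧ z i < 1 + δ) → |z k - 1| < δ →
      Vc p t z = Wv k t (z - faceMidpoint k true) ∧ Θc p t z = Wθ k t (z - faceMidpoint k true)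
  /-- outer upper sides, elsewhere -/
  outer_hi_vanish : ∀ (p : Fin 2 → Fin 5) (k : Fin 2), (p k : ℕ) = 4 →
    (¬ gate k true = true ∨ ∃ j, j ≠ k ∧ (p j : ℕ) ≠ 2) → ∀ (t : ℝ) (z : E²),
      (∀ i, -δ < z i ∧ z i < 1 + δ) → |z k - 1| < δ → Vc p t z = 0 ∧ Θc p t z = 0
  /-- window velocities are tangent to their face -/
  W_tangent : ∀ (k : Fin 2) (t : ℝ) (ζ : E²), ζ k = 0 → Wv k t ζ k = 0
  /-- window fields vanish at transversal offset `≥ δ` -/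
  W_vanish : ∀ (k : Fin 2) (t : ℝ) (ζ : E²), (∃ j, j ≠ k ∧ δ ≤ |ζ j|) → Wv k t ζ = 0 ∧ Wθ k t ζ = 0

/-! ## The exterior field and the blocks -/

section Fields

variable (Vc : (Fin 2 → Fin 5) → ℝ → E² → E²) (Θc : (Fin 2 → Fin 5) → ℝ → E² → ℝ)
  (gate : Fin 2 → Bool → Bool) (Wv : Fin 2 → ℝ → E² → E²) (Wθ : Fin 2 → ℝ → E² → ℝ) (δ : ℝ)

/-- The normal cut-off of the exterior field: `Gluing.plateau (-2δ) (2δ) δ`, equal to `1` on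
`[-4δ/3, 4δ/3]` and to `0` outside `(-5δ/3, 5δ/3)`. [folklore] -/
def normalCutoff (x : ℝ) : ℝ := Gluing.plateau (-(2 * δ)) (2 * δ) δ x

/-- **The exterior velocity** (big coordinates): the window velocities placed at the gates of
the big square (scaled by `5⁻¹` in space and amplitude), cut off in the normal variable at
distance `∼ δ/5` from the face. Only its values outside `[0,1)²` are patched in. [folklore] -/
def exteriorV (t : ℝ) (y : E²) : E² :=
  ∑ k : Fin 2, ∑ s : Bool, if gate k s = true then
    normalCutoff (δ / 5) (y k - faceValue s) • (5 : ℝ)⁻¹ • Wv k t ((5 : ℝ) • (y - faceMidpoint k s))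
  else 0

/-- **The exterior scalar** (big coordinates). [folklore] -/
def exteriorΘ (t : ℝ) (y : E²) : ℝ :=
  ∑ k : Fin 2, ∑ s : Bool, if gate k s = true then
    normalCutoff (δ / 5) (y k - faceValue s) * Wθ k t ((5 : ℝ) • (y - faceMidpoint k s))
  else 0

/-- **The velocity blocks** indexed by all integer pairs: the rescaled cell velocity on an inner
index, the exterior velocity read in the chart of the cell otherwise. [folklore] -/
def cellBlockV (κ : Fin 2 → ℤ) (t : ℝ) (z : E²) : E² :=
  if IsInner κ then (5 : ℝ)⁻¹ • Vc (toCell κ) t z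
  else exteriorV gate Wv δ t ((5 : ℝ)⁻¹ • (z + latticeVec κ))

/-- **The scalar blocks** indexed by all integer pairs. [folklore] -/
def cellBlockΘ (κ : Fin 2 → ℤ) (t : ℝ) (z : E²) : ℝ :=
  if IsInner κ then Θc (toCell κ) t z
  else exteriorΘ gate Wθ δ t ((5 : ℝ)⁻¹ • (z + latticeVec κ))

/-- **The glued velocity of the cellwise stage** on `ℝ × ℝ²`: the patch of the velocity blocks
at mesh `1/5`. [cite: AlbertiCrippaMazzucato2019, §8.10–8.11] -/
def cellwiseV (t : ℝ) (y : E²) : E² := patch 5 id (fun κ => cellBlockV Vc gate Wv δ κ t) y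

/-- **The glued scalar of the cellwise stage** on `ℝ × ℝ²`. [cite: AlbertiCrippaMazzucato2019, §8.10–8.11] -/
def cellwiseΘ (t : ℝ) (y : E²) : ℝ := patch 5 id (fun κ => cellBlockΘ Θc gate Wθ δ κ t) y

/-- **The gate velocity of the glued move**: the window velocity rescaled to the big square,
`Vg k t ξ = 5⁻¹ • Wv k t (5 • ξ)`. [folklore] -/
def gateV (k : Fin 2) (t : ℝ) (ξ : E²) : E² := (5 : ℝ)⁻¹ • Wv k t ((5 : ℝ) • ξ)

/-- **The gate scalar of the glued move**: `Θg k t ξ = Wθ k t (5 • ξ)`. [folklore] -/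
def gateΘ (k : Fin 2) (t : ℝ) (ξ : E²) : ℝ := Wθ k t ((5 : ℝ) • ξ)

end Fields

/-! ## The exterior field on the boundary strips -/

section Exterior

variable {gate : Fin 2 → Bool → Bool} {Wv : Fin 2 → ℝ → E² → E²} {Wθ : Fin 2 → ℝ → E² → ℝ} {δ : ℝ}

/-- The normal cut-off is `1` for `|x| ≤ δ`. [folklore] -/
theorem normalCutoff_eq_one (hδ : 0 < δ) {x : ℝ} (hx : |x| ≤ δ) : normalCutoff δ x = 1 := by
  rw [abs_le] at hx
  exact Gluing.plateau_of_mem hδ (by linarith [hx.1]) (by linarith [hx.2])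

/-- The normal cut-off vanishes for `|x| ≥ 2δ`. [folklore] -/
theorem normalCutoff_eq_zero (hδ : 0 < δ) {x : ℝ} (hx : 2 * δ ≤ |x|) : normalCutoff δ x = 0 := by
  rcases le_abs'.1 hx with h | h
  · exact Gluing.plateau_of_le_left hδ (by linarith)
  · exact Gluing.plateau_of_ge_right hδ (by linarith)

/-- The normal cut-off is smooth. [folklore] -/
theorem normalCutoff_contDiff : ContDiff ℝ ∞ (normalCutoff δ) :=
  Gluing.plateau_contDiff (n := ⊤)

/-- The other index of `Fin 2`. [folklore] -/
theorem fin_two_eq_of_ne {j k : Fin 2} (h : j ≠ k) : j = k + 1 := by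
  fin_cases j <;> fin_cases k <;> simp_all

/-- For `j ≠ k` in `Fin 2`, `k ≠ j`-indexed statements reduce to the one other index. [folklore] -/
theorem fin_two_forall_ne {k : Fin 2} {P : Fin 2 → Prop} : (∀ j, j ≠ k → P j) ↔ P (k + 1) := by
  constructor
  · intro h; exact h (k + 1) (by fin_cases k <;> decide)
  · intro h j hj; rwa [fin_two_eq_of_ne hj]

/-- Coordinates of the scaled offset from a face midpoint. [folklore] -/
theorem smul_sub_faceMidpoint_apply (y : E²) (k : Fin 2) (s : Bool) (j : Fin 2) :
    ((5 : ℝ) • (y - faceMidpoint k s)) j = 5 * (y j - if j = k then faceValue s else 2⁻¹) := by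
  rw [PiLp.smul_apply, PiLp.sub_apply, faceMidpoint_apply, smul_eq_mul]

variable (hWvan : ∀ (k : Fin 2) (t : ℝ) (ζ : E²), (∃ j, j ≠ k ∧ δ ≤ |ζ j|) → Wv k t ζ = 0 ∧ Wθ k t ζ = 0)
include hWvan

/-- Near the face `(k, s)` of the big square the window fields of the perpendicular faces vanish
(their transversal offset there is `≥ 5/2 - δ ≥ δ`). [folklore] -/
theorem window_perp_eq_zero (hδ1 : δ ≤ 8⁻¹) {k : Fin 2} {s : Bool} {y : E²}
    (hy : |y k - faceValue s| < δ / 5) (t : ℝ) (s' : Bool) :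
    Wv (k + 1) t ((5 : ℝ) • (y - faceMidpoint (k + 1) s')) = 0 ∧
      Wθ (k + 1) t ((5 : ℝ) • (y - faceMidpoint (k + 1) s')) = 0 := by
  refine hWvan (k + 1) t _ ⟨k, by fin_cases k <;> decide, ?_⟩
  rw [smul_sub_faceMidpoint_apply]
  have hk : (k : Fin 2) ≠ k + 1 := by fin_cases k <;> decide
  rw [if_neg hk]
  have h1 : |y k - faceValue s| < 1 / 4 := lt_of_lt_of_le hy (by linarith)
  rw [abs_lt] at h1
  rw [abs_mul, Nat.abs_ofNat]
  have : 2⁻¹ - 1 / 4 ≤ |y k - 2⁻¹| := by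
    cases s
    · rw [faceValue_false] at h1; rw [le_abs']; left; linarith [h1.2]
    · rw [faceValue_true] at h1; rw [le_abs']; right; linarith [h1.1]
  linarith

omit hWvan in
/-- Near a face, the normal cut-off of the opposite face vanishes. [folklore] -/
theorem normalCutoff_opposite_eq_zero (hδ : 0 < δ) (hδ1 : δ ≤ 8⁻¹) {k : Fin 2} {s : Bool} {y : E²}
    (hy : |y k - faceValue s| < δ / 5) : normalCutoff (δ / 5) (y k - faceValue (!s)) = 0 := by
  apply normalCutoff_eq_zero (by positivity)
  rw [abs_lt] at hy
  cases s
  · simp only [faceValue_false, Bool.not_false, faceValue_true] at hy ⊢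
    rw [le_abs']; left; linarith [hy.2]
  · simp only [faceValue_true, Bool.not_true, faceValue_false] at hy ⊢
    rw [le_abs']; right; linarith [hy.1]

/-- **The exterior velocity on the strip of the face `(k, s)`**: the window velocity of that face
if it is a gate, zero otherwise. [folklore] -/
theorem exteriorV_of_strip (hδ : 0 < δ) (hδ1 : δ ≤ 8⁻¹) {k : Fin 2} {s : Bool} {y : E²}
    (hy : |y k - faceValue s| < δ / 5) (t : ℝ) :
    exteriorV gate Wv δ t y =
      if gate k s = true then (5 : ℝ)⁻¹ • Wv k t ((5 : ℝ) • (y - faceMidpoint k s)) else 0 := by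
  have hself : normalCutoff (δ / 5) (y k - faceValue s) = 1 :=
    normalCutoff_eq_one (by positivity) hy.le
  have hopp := normalCutoff_opposite_eq_zero hδ hδ1 hy
  have hperp := fun s' => (window_perp_eq_zero hWvan hδ1 hy t s').1
  unfold exteriorV
  have h1 : ∀ k' ∈ (Finset.univ : Finset (Fin 2)), k' ≠ k → (∑ s' : Bool, (if gate k' s' = true then
      normalCutoff (δ / 5) (y k' - faceValue s') • (5 : ℝ)⁻¹ • Wv k' t ((5 : ℝ) • (y - faceMidpoint k' s'))
      else 0)) = 0 := by
    intro k' _ hk'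
    obtain rfl : k' = k + 1 := fin_two_eq_of_ne hk'
    refine Finset.sum_eq_zero fun s' _ => ?_
    split_ifs
    · rw [hperp s', smul_zero, smul_zero]
    · rfl
  rw [Finset.sum_eq_single_of_mem k (Finset.mem_univ _) h1]
  have h2 : ∀ s' ∈ (Finset.univ : Finset Bool), s' ≠ s → (if gate k s' = true then
      normalCutoff (δ / 5) (y k - faceValue s') • (5 : ℝ)⁻¹ • Wv k t ((5 : ℝ) • (y - faceMidpoint k s'))
      else 0) = 0 := by
    intro s' _ hs'
    obtain rfl : s' = !s := by cases s <;> cases s' <;> simp_all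
    split_ifs
    · rw [hopp, zero_smul]
    · rfl
  rw [Finset.sum_eq_single_of_mem s (Finset.mem_univ _) h2]
  split_ifs
  · rw [hself, one_smul]
  · rfl

/-- **The exterior scalar on the strip of the face `(k, s)`**. [folklore] -/
theorem exteriorΘ_of_strip (hδ : 0 < δ) (hδ1 : δ ≤ 8⁻¹) {k : Fin 2} {s : Bool} {y : E²}
    (hy : |y k - faceValue s| < δ / 5) (t : ℝ) :
    exteriorΘ gate Wθ δ t y =
      if gate k s = true then Wθ k t ((5 : ℝ) • (y - faceMidpoint k s)) else 0 := by
  have hself : normalCutoff (δ / 5) (y k - faceValue s) = 1 :=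
    normalCutoff_eq_one (by positivity) hy.le
  have hopp := normalCutoff_opposite_eq_zero hδ hδ1 hy
  have hperp := fun s' => (window_perp_eq_zero hWvan hδ1 hy t s').2
  unfold exteriorΘ
  have h1 : ∀ k' ∈ (Finset.univ : Finset (Fin 2)), k' ≠ k → (∑ s' : Bool, (if gate k' s' = true then
      normalCutoff (δ / 5) (y k' - faceValue s') * Wθ k' t ((5 : ℝ) • (y - faceMidpoint k' s'))
      else 0)) = 0 := by
    intro k' _ hk'
    obtain rfl : k' = k + 1 := fin_two_eq_of_ne hk'
    refine Finset.sum_eq_zero fun s' _ => ?_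
    split_ifs
    · rw [hperp s', mul_zero]
    · rfl
  rw [Finset.sum_eq_single_of_mem k (Finset.mem_univ _) h1]
  have h2 : ∀ s' ∈ (Finset.univ : Finset Bool), s' ≠ s → (if gate k s' = true then
      normalCutoff (δ / 5) (y k - faceValue s') * Wθ k t ((5 : ℝ) • (y - faceMidpoint k s'))
      else 0) = 0 := by
    intro s' _ hs'
    obtain rfl : s' = !s := by cases s <;> cases s' <;> simp_all
    split_ifs
    · rw [hopp, zero_mul]
    · rfl
  rw [Finset.sum_eq_single_of_mem s (Finset.mem_univ _) h2]
  split_ifs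
  · rw [hself, one_mul]
  · rfl

end Exterior

/-! ## Compatibility of the blocks -/

section Compat

/-- Every index of `Fin 2` is `k` or `k + 1`. [folklore] -/
theorem fin_two_eq_or (j k : Fin 2) : j = k ∨ j = k + 1 := by
  fin_cases j <;> fin_cases k <;> simp

/-- `k + 1 ≠ k` in `Fin 2`. [folklore] -/
theorem fin_two_succ_ne (k : Fin 2) : k + 1 ≠ k := by fin_cases k <;> decide

/-- The lattice vector of a unit integer vector is the unit vector. [folklore] -/
theorem latticeVec_single (k : Fin 2) :
    latticeVec (Pi.single k (1 : ℤ)) = EuclideanSpace.single k (1 : ℝ) := by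
  ext j
  rw [latticeVec_apply, PiLp.single_apply]
  by_cases hj : j = k
  · subst hj; simp
  · simp [hj]

/-- Coordinates of `κ - e_k`: the `k`-th drops by one. [folklore] -/
theorem sub_single_apply_self (κ : Fin 2 → ℤ) (k : Fin 2) :
    (κ - (Pi.single k (1 : ℤ) : Fin 2 → ℤ)) k = κ k - 1 := by
  simp

/-- Coordinates of `κ - e_k`: the other one is unchanged. [folklore] -/
theorem sub_single_apply_succ (κ : Fin 2 → ℤ) (k : Fin 2) :
    (κ - (Pi.single k (1 : ℤ) : Fin 2 → ℤ)) (k + 1) = κ (k + 1) := by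
  simp [fin_two_succ_ne k]

/-- `latticeVec (κ - e_k) + e_k = latticeVec κ`. [folklore] -/
theorem latticeVec_sub_single_add (κ : Fin 2 → ℤ) (k : Fin 2) :
    latticeVec (κ - Pi.single k 1) + latticeVec (Pi.single k (1 : ℤ)) = latticeVec κ := by
  rw [← latticeVec_add, sub_add_cancel]

variable {S : Set ℝ} {Vc : (Fin 2 → Fin 5) → ℝ → E² → E²} {Θc : (Fin 2 → Fin 5) → ℝ → E² → ℝ}
  {gate : Fin 2 → Bool → Bool} {Wv : Fin 2 → ℝ → E² → E²} {Wθ : Fin 2 → ℝ → E² → ℝ} {δ : ℝ}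

/-- If `κ` and `κ - e_k` are both inner, the cell of `κ` is the upper neighbour of the cell of
`κ - e_k` in direction `k`. [folklore] -/
theorem toCell_eq_update {κ : Fin 2 → ℤ} {k : Fin 2} (hκ : IsInner κ) (hκ' : IsInner (κ - Pi.single k 1))
    (hlt : ((toCell (κ - Pi.single k 1) k : ℕ)) + 1 < 5) :
    toCell κ = update (toCell (κ - Pi.single k 1)) k ⟨(toCell (κ - Pi.single k 1) k : ℕ) + 1, hlt⟩ := by
  funext j
  rcases fin_two_eq_or j k with rfl | rfl
  · rw [update_self]
    apply Fin.ext
    have h1 := natCast_toCell hκ j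
    have h2 := natCast_toCell hκ' j
    rw [sub_single_apply_self] at h2
    have : ((toCell κ j : ℕ) : ℤ) = ((toCell (κ - Pi.single j 1) j : ℕ) : ℤ) + 1 := by rw [h1, h2]; ring
    exact_mod_cast this
  · rw [update_of_ne (fin_two_succ_ne k)]
    apply Fin.ext
    have h1 := natCast_toCell hκ (k + 1)
    have h2 := natCast_toCell hκ' (k + 1)
    rw [sub_single_apply_succ] at h2
    exact_mod_cast (h1.trans h2.symm)

/-- Inner `κ` with non-inner `κ - e_k`: `κ_k = 0`. [folklore] -/
theorem eq_zero_of_isInner_of_not {κ : Fin 2 → ℤ} {k : Fin 2} (hκ : IsInner κ)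
    (hκ' : ¬ IsInner (κ - Pi.single k 1)) : κ k = 0 := by
  by_contra hne
  apply hκ'
  intro j
  rcases fin_two_eq_or j k with rfl | rfl
  · rw [sub_single_apply_self]; have := hκ j; omega
  · rw [sub_single_apply_succ]; exact hκ (k + 1)

/-- Non-inner `κ` with inner `κ - e_k`: `κ_k = 5`. [folklore] -/
theorem eq_five_of_not_isInner_of {κ : Fin 2 → ℤ} {k : Fin 2} (hκ : ¬ IsInner κ)
    (hκ' : IsInner (κ - Pi.single k 1)) : κ k = 5 := by
  by_contra hne
  apply hκ
  intro j
  rcases fin_two_eq_or j k with rfl | rfl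
  · have := hκ' j; rw [sub_single_apply_self] at this; omega
  · have := hκ' (k + 1); rwa [sub_single_apply_succ] at this

/-- The transversal coordinate of a scaled offset is far from the window when the cell is not
the middle one: `|z_j + κ_j - 5/2| ≥ 1/2 - δ` for `κ_j ∈ {0,1,3,4}`, `z_j ∈ (-δ, 1+δ)`. [folklore] -/
theorem half_sub_le_abs_of_ne_two {κj : ℤ} (h0 : 0 ≤ κj) (h5 : κj < 5) (h2 : κj ≠ 2) {zj δ : ℝ}
    (hz : -δ < zj ∧ zj < 1 + δ) : 2⁻¹ - δ ≤ |zj + κj - 5 / 2| := by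
  have hcases : κj = 0 ∨ κj = 1 ∨ κj = 3 ∨ κj = 4 := by omega
  rw [le_abs']
  rcases hcases with h | h | h | h <;> subst h <;> push_cast
  · left; linarith [hz.2]
  · left; linarith [hz.2]
  · right; linarith [hz.1]
  · right; linarith [hz.1]

namespace IsCellFamily

variable (h : IsCellFamily S Vc Θc gate Wv Wθ δ)
include h

/-- `δ ≤ 1/4`. [folklore] -/
theorem δ_le_quarter : δ ≤ 4⁻¹ := h.δ_le.trans (by norm_num)

/-- **Face compatibility of the blocks** (both fields at once): for every integer pair `κ`, axis
`k`, time `t` and block coordinates `z ∈ (-δ, 1+δ)²` with `|z_k| < δ`, the block of `κ` at `z`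
equals the block of `κ - e_k` at `z + e_k`. Four cases: both cells inner (hypothesis `compat`),
inner/outer across a lower outer side (`outer_lo_*` against the exterior field), outer/inner
across an upper outer side (`outer_hi_*`), both outer (the same exterior field). [folklore] -/
theorem cellBlock_face (κ : Fin 2 → ℤ) (k : Fin 2) (t : ℝ) (z : E²)
    (hz : ∀ i, -δ < z i ∧ z i < 1 + δ) (hk : |z k| < δ) :
    cellBlockV Vc gate Wv δ κ t z =
        cellBlockV Vc gate Wv δ (κ - Pi.single k 1) t (z + latticeVec (Pi.single k (1 : ℤ))) ∧
      cellBlockΘ Θc gate Wθ δ κ t z =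
        cellBlockΘ Θc gate Wθ δ (κ - Pi.single k 1) t (z + latticeVec (Pi.single k (1 : ℤ))) := by
  have hδ := h.δ_pos
  have hδ4 := h.δ_le_quarter
  set κ' := κ - Pi.single k 1 with hκ'
  have hκ'k : κ' k = κ k - 1 := by rw [hκ']; exact sub_single_apply_self κ k
  have hκ's : κ' (k + 1) = κ (k + 1) := by rw [hκ']; exact sub_single_apply_succ κ k
  -- the common big point of the two charts
  have harg : (5 : ℝ)⁻¹ • (z + latticeVec (Pi.single k (1 : ℤ)) + latticeVec κ') =
      (5 : ℝ)⁻¹ • (z + latticeVec κ) := by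
    rw [add_assoc, add_comm (latticeVec _), latticeVec_sub_single_add]
  set y : E² := (5 : ℝ)⁻¹ • (z + latticeVec κ) with hy
  have hy_apply : ∀ j, y j = 5⁻¹ * (z j + κ j) := fun j => by
    rw [hy, PiLp.smul_apply, PiLp.add_apply, latticeVec_apply, smul_eq_mul]
  have h5y : ∀ (kk : Fin 2) (s : Bool) (j : Fin 2), ((5 : ℝ) • (y - faceMidpoint kk s)) j =
      z j + κ j - 5 * (if j = kk then faceValue s else 2⁻¹) := by
    intro kk s j
    rw [smul_sub_faceMidpoint_apply, hy_apply]; ring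
  by_cases hκ : IsInner κ <;> by_cases hκ'i : IsInner κ'
  · -- both inner
    have hlt : ((toCell κ' k : ℕ)) + 1 < 5 := by
      have h2 := natCast_toCell hκ'i k
      rw [hκ'k] at h2
      have := (hκ k).2
      omega
    have hup := toCell_eq_update hκ hκ'i hlt
    obtain ⟨hV, hΘ⟩ := h.compat (toCell κ') k hlt t z hz hk
    rw [← hup, ← latticeVec_single] at hV hΘ
    simp only [cellBlockV, cellBlockΘ, if_pos hκ, if_pos hκ'i]
    exact ⟨by rw [hV], by rw [hΘ]⟩
  · -- inner / lower outer side
    have hk0 : κ k = 0 := eq_zero_of_isInner_of_not hκ hκ'i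
    have hpk : (toCell κ k : ℕ) = 0 := by
      have := natCast_toCell hκ k; rw [hk0] at this; exact_mod_cast this
    have hstrip : |y k - faceValue false| < δ / 5 := by
      rw [hy_apply, hk0, faceValue_false]
      simp only [Int.cast_zero, add_zero, sub_zero, abs_mul, abs_inv, Nat.abs_ofNat]
      linarith
    simp only [cellBlockV, cellBlockΘ, if_pos hκ, if_neg hκ'i, harg]
    rw [exteriorV_of_strip h.W_vanish hδ h.δ_le hstrip, exteriorΘ_of_strip h.W_vanish hδ h.δ_le hstrip]
    by_cases hg : gate k false = true
    · rw [if_pos hg, if_pos hg]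
      by_cases hmid : ∀ j, j ≠ k → (toCell κ j : ℕ) = 2
      · obtain ⟨hV, hΘ⟩ := h.outer_lo_gate (toCell κ) k hpk hg hmid t z hz hk
        have h2 : κ (k + 1) = 2 := by
          have := natCast_toCell hκ (k + 1)
          rw [hmid (k + 1) (fin_two_succ_ne k)] at this
          exact_mod_cast this.symm
        have hvec : (5 : ℝ) • (y - faceMidpoint k false) = z - faceMidpoint k false := by
          ext j
          rcases fin_two_eq_or j k with hj | hj <;> rw [hj]
          · rw [h5y, if_pos rfl, PiLp.sub_apply, faceMidpoint_apply, if_pos rfl, hk0, faceValue_false]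
            push_cast; ring
          · rw [h5y, if_neg (fin_two_succ_ne k), PiLp.sub_apply, faceMidpoint_apply,
              if_neg (fin_two_succ_ne k), h2]
            push_cast; ring
        rw [hvec, hV, hΘ]; exact ⟨rfl, rfl⟩
      · rw [fin_two_forall_ne] at hmid
        obtain ⟨hV, hΘ⟩ := h.outer_lo_vanish (toCell κ) k hpk (Or.inr ⟨k + 1, fin_two_succ_ne k, hmid⟩) t z hz hk
        have hfar : δ ≤ |((5 : ℝ) • (y - faceMidpoint k false)) (k + 1)| := by
          rw [h5y, if_neg (fin_two_succ_ne k)]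
          have hne : κ (k + 1) ≠ 2 := by
            intro h2; apply hmid
            have := natCast_toCell hκ (k + 1); rw [h2] at this; exact_mod_cast this
          have := half_sub_le_abs_of_ne_two (hκ (k + 1)).1 (hκ (k + 1)).2 hne (hz (k + 1))
          have e : z (k + 1) + ↑(κ (k + 1)) - 5 * 2⁻¹ = z (k + 1) + ↑(κ (k + 1)) - 5 / 2 := by ring
          rw [e]; linarith
        obtain ⟨hW1, hW2⟩ := h.W_vanish k t _ ⟨k + 1, fin_two_succ_ne k, hfar⟩
        rw [hV, hΘ, hW1, hW2, smul_zero]; exact ⟨by simp, rfl⟩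
    · rw [if_neg hg, if_neg hg]
      obtain ⟨hV, hΘ⟩ := h.outer_lo_vanish (toCell κ) k hpk (Or.inl hg) t z hz hk
      rw [hV, hΘ, smul_zero]; exact ⟨rfl, rfl⟩
  · -- upper outer side / inner
    have hk5 : κ k = 5 := eq_five_of_not_isInner_of hκ hκ'i
    have hpk : (toCell κ' k : ℕ) = 4 := by
      have := natCast_toCell hκ'i k; rw [hκ'k, hk5] at this; omega
    have hstrip : |y k - faceValue true| < δ / 5 := by
      rw [hy_apply, hk5, faceValue_true]
      have e : (5 : ℝ)⁻¹ * (z k + ((5 : ℤ) : ℝ)) - 1 = 5⁻¹ * z k := by push_cast; ring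
      rw [e, abs_mul, abs_inv, Nat.abs_ofNat]
      linarith
    set z' : E² := z + latticeVec (Pi.single k (1 : ℤ)) with hz'
    have hz'_apply_k : z' k = z k + 1 := by
      rw [hz', latticeVec_single, PiLp.add_apply, PiLp.single_apply, if_pos rfl]
    have hz'_apply_succ : z' (k + 1) = z (k + 1) := by
      rw [hz', latticeVec_single, PiLp.add_apply, PiLp.single_apply, if_neg (fin_two_succ_ne k), add_zero]
    have hz'range : ∀ i, -δ < z' i ∧ z' i < 1 + δ := by
      intro i
      rcases fin_two_eq_or i k with rfl | rfl
      · rw [hz'_apply_k]; rw [abs_lt] at hk; constructor <;> linarith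
      · rw [hz'_apply_succ]; exact hz (k + 1)
    have hk' : |z' k - 1| < δ := by rw [hz'_apply_k, add_sub_cancel_right]; exact hk
    simp only [cellBlockV, cellBlockΘ, if_neg hκ, if_pos hκ'i]
    rw [← hy, exteriorV_of_strip h.W_vanish hδ h.δ_le hstrip, exteriorΘ_of_strip h.W_vanish hδ h.δ_le hstrip]
    by_cases hg : gate k true = true
    · rw [if_pos hg, if_pos hg]
      by_cases hmid : ∀ j, j ≠ k → (toCell κ' j : ℕ) = 2
      · obtain ⟨hV, hΘ⟩ := h.outer_hi_gate (toCell κ') k hpk hg hmid t z' hz'range hk'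
        have h2 : κ (k + 1) = 2 := by
          have := natCast_toCell hκ'i (k + 1)
          rw [hmid (k + 1) (fin_two_succ_ne k), hκ's] at this
          exact_mod_cast this.symm
        have hvec : (5 : ℝ) • (y - faceMidpoint k true) = z' - faceMidpoint k true := by
          ext j
          rcases fin_two_eq_or j k with hj | hj <;> rw [hj]
          · rw [h5y, if_pos rfl, PiLp.sub_apply, faceMidpoint_apply, if_pos rfl, hz'_apply_k, hk5,
              faceValue_true]
            push_cast; ring
          · rw [h5y, if_neg (fin_two_succ_ne k), PiLp.sub_apply, faceMidpoint_apply,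
              if_neg (fin_two_succ_ne k), h2, hz'_apply_succ]
            push_cast; ring
        rw [hvec, hV, hΘ]; exact ⟨rfl, rfl⟩
      · rw [fin_two_forall_ne] at hmid
        obtain ⟨hV, hΘ⟩ := h.outer_hi_vanish (toCell κ') k hpk (Or.inr ⟨k + 1, fin_two_succ_ne k, hmid⟩) t z' hz'range hk'
        have hfar : δ ≤ |((5 : ℝ) • (y - faceMidpoint k true)) (k + 1)| := by
          rw [h5y, if_neg (fin_two_succ_ne k)]
          have hne : κ (k + 1) ≠ 2 := by
            intro h2; apply hmid
            have := natCast_toCell hκ'i (k + 1)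
            rw [hκ's, h2] at this; exact_mod_cast this
          have hin := hκ'i (k + 1)
          rw [hκ's] at hin
          have := half_sub_le_abs_of_ne_two hin.1 hin.2 hne (hz (k + 1))
          have e : z (k + 1) + ↑(κ (k + 1)) - 5 * 2⁻¹ = z (k + 1) + ↑(κ (k + 1)) - 5 / 2 := by ring
          rw [e]; linarith
        obtain ⟨hW1, hW2⟩ := h.W_vanish k t _ ⟨k + 1, fin_two_succ_ne k, hfar⟩
        rw [hV, hΘ, hW1, hW2, smul_zero]; exact ⟨by simp, rfl⟩
    · rw [if_neg hg, if_neg hg]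
      obtain ⟨hV, hΘ⟩ := h.outer_hi_vanish (toCell κ') k hpk (Or.inl hg) t z' hz'range hk'
      rw [hV, hΘ, smul_zero]; exact ⟨rfl, rfl⟩
  · -- both outer
    simp only [cellBlockV, cellBlockΘ, if_neg hκ, if_neg hκ'i, harg]
    exact ⟨rfl, rfl⟩

/-- **The velocity blocks are locally compatible.** [folklore] -/
theorem patchCompatibleNear_cellBlockV : PatchCompatibleNear id (cellBlockV Vc gate Wv δ) δ := by
  intro κ e he t z hz hstrip
  have hδ := h.δ_pos
  rcases he 0 with h0 | h0 <;> rcases he 1 with h1 | h1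
  · have he0 : e = 0 := by funext i; fin_cases i <;> assumption
    simp [he0, latticeVec]
  · have he1 : e = Pi.single 1 1 := by funext i; fin_cases i <;> simp [h0, h1]
    subst he1
    exact (h.cellBlock_face κ 1 t z hz (hstrip 1 (by simp))).1
  · have he1 : e = Pi.single 0 1 := by funext i; fin_cases i <;> simp [h0, h1]
    subst he1
    exact (h.cellBlock_face κ 0 t z hz (hstrip 0 (by simp))).1
  · -- corner: two faces
    have hface0 := (h.cellBlock_face κ 0 t z hz (hstrip 0 h0)).1
    set z' : E² := z + latticeVec (Pi.single (0 : Fin 2) (1 : ℤ)) with hz'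
    have hz'0 : z' 0 = z 0 + 1 := by
      rw [hz', latticeVec_single, PiLp.add_apply, PiLp.single_apply, if_pos rfl]
    have hz'1 : z' 1 = z 1 := by
      rw [hz', latticeVec_single, PiLp.add_apply, PiLp.single_apply, if_neg (by decide), add_zero]
    have hz'range : ∀ i, -δ < z' i ∧ z' i < 1 + δ := by
      intro i; fin_cases i
      · have := hstrip 0 h0; rw [abs_lt] at this
        show -δ < z' 0 ∧ z' 0 < 1 + δ
        rw [hz'0]; constructor <;> linarith
      · show -δ < z' 1 ∧ z' 1 < 1 + δ
        rw [hz'1]; exact hz 1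
    have hface1 := (h.cellBlock_face (κ - Pi.single 0 1) 1 t z' hz'range (by rw [hz'1]; exact hstrip 1 h1)).1
    have hκe : κ - e = κ - Pi.single 0 1 - Pi.single 1 1 := by
      funext i; fin_cases i <;> simp [h0, h1]
    have hze : z + latticeVec e = z' + latticeVec (Pi.single (1 : Fin 2) (1 : ℤ)) := by
      have : e = Pi.single 0 1 + Pi.single 1 1 := by funext i; fin_cases i <;> simp [h0, h1]
      rw [this, latticeVec_add, hz', add_assoc]
    rw [id, hκe, hze]
    exact hface0.trans hface1

/-- **The scalar blocks are locally compatible.** [folklore] -/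
theorem patchCompatibleNear_cellBlockΘ : PatchCompatibleNear id (cellBlockΘ Θc gate Wθ δ) δ := by
  intro κ e he t z hz hstrip
  have hδ := h.δ_pos
  rcases he 0 with h0 | h0 <;> rcases he 1 with h1 | h1
  · have he0 : e = 0 := by funext i; fin_cases i <;> assumption
    simp [he0, latticeVec]
  · have he1 : e = Pi.single 1 1 := by funext i; fin_cases i <;> simp [h0, h1]
    subst he1
    exact (h.cellBlock_face κ 1 t z hz (hstrip 1 (by simp))).2
  · have he1 : e = Pi.single 0 1 := by funext i; fin_cases i <;> simp [h0, h1]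
    subst he1
    exact (h.cellBlock_face κ 0 t z hz (hstrip 0 (by simp))).2
  · have hface0 := (h.cellBlock_face κ 0 t z hz (hstrip 0 h0)).2
    set z' : E² := z + latticeVec (Pi.single (0 : Fin 2) (1 : ℤ)) with hz'
    have hz'0 : z' 0 = z 0 + 1 := by
      rw [hz', latticeVec_single, PiLp.add_apply, PiLp.single_apply, if_pos rfl]
    have hz'1 : z' 1 = z 1 := by
      rw [hz', latticeVec_single, PiLp.add_apply, PiLp.single_apply, if_neg (by decide), add_zero]
    have hz'range : ∀ i, -δ < z' i ∧ z' i < 1 + δ := by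
      intro i; fin_cases i
      · have := hstrip 0 h0; rw [abs_lt] at this
        show -δ < z' 0 ∧ z' 0 < 1 + δ
        rw [hz'0]; constructor <;> linarith
      · show -δ < z' 1 ∧ z' 1 < 1 + δ
        rw [hz'1]; exact hz 1
    have hface1 := (h.cellBlock_face (κ - Pi.single 0 1) 1 t z' hz'range (by rw [hz'1]; exact hstrip 1 h1)).2
    have hκe : κ - e = κ - Pi.single 0 1 - Pi.single 1 1 := by
      funext i; fin_cases i <;> simp [h0, h1]
    have hze : z + latticeVec e = z' + latticeVec (Pi.single (1 : Fin 2) (1 : ℤ)) := by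
      have : e = Pi.single 0 1 + Pi.single 1 1 := by funext i; fin_cases i <;> simp [h0, h1]
      rw [this, latticeVec_add, hz', add_assoc]
    rw [id, hκe, hze]
    exact hface0.trans hface1

end IsCellFamily

end Compat

/-! ## Smoothness and values of the glued fields -/

section Glued

variable {S : Set ℝ} {Vc : (Fin 2 → Fin 5) → ℝ → E² → E²} {Θc : (Fin 2 → Fin 5) → ℝ → E² → ℝ}
  {gate : Fin 2 → Bool → Bool} {Wv : Fin 2 → ℝ → E² → E²} {Wθ : Fin 2 → ℝ → E² → ℝ} {δ : ℝ}

namespace IsCellFamily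

variable (h : IsCellFamily S Vc Θc gate Wv Wθ δ)
include h

/-- The exterior velocity is smooth. [folklore] -/
theorem contDiff_exteriorV : ContDiff ℝ ∞ (uncurry (exteriorV gate Wv δ)) := by
  have e : uncurry (exteriorV gate Wv δ) = fun p : ℝ × E² => ∑ k : Fin 2, ∑ s : Bool,
      (if gate k s = true then normalCutoff (δ / 5) (p.2 k - faceValue s) •
        (5 : ℝ)⁻¹ • Wv k p.1 ((5 : ℝ) • (p.2 - faceMidpoint k s)) else 0) := by
    funext p; rfl
  rw [e]
  refine ContDiff.sum fun k _ => ContDiff.sum fun s _ => ?_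
  by_cases hg : gate k s = true
  · simp only [if_pos hg]
    have hc : ContDiff ℝ ∞ fun p : ℝ × E² => normalCutoff (δ / 5) (p.2 k - faceValue s) :=
      normalCutoff_contDiff.comp ((((EuclideanSpace.proj k : E² →L[ℝ] ℝ).contDiff).comp contDiff_snd).sub contDiff_const)
    have hW : ContDiff ℝ ∞ fun p : ℝ × E² => (5 : ℝ)⁻¹ • Wv k p.1 ((5 : ℝ) • (p.2 - faceMidpoint k s)) :=
      ((h.smooth_Wv k).comp (contDiff_fst.prodMk ((contDiff_snd.sub contDiff_const).const_smul _))).const_smul _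
    exact hc.smul hW
  · simp only [if_neg hg]; exact contDiff_const

/-- The exterior scalar is smooth. [folklore] -/
theorem contDiff_exteriorΘ : ContDiff ℝ ∞ (uncurry (exteriorΘ gate Wθ δ)) := by
  have e : uncurry (exteriorΘ gate Wθ δ) = fun p : ℝ × E² => ∑ k : Fin 2, ∑ s : Bool,
      (if gate k s = true then normalCutoff (δ / 5) (p.2 k - faceValue s) *
        Wθ k p.1 ((5 : ℝ) • (p.2 - faceMidpoint k s)) else 0) := by
    funext p; rfl
  rw [e]
  refine ContDiff.sum fun k _ => ContDiff.sum fun s _ => ?_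
  by_cases hg : gate k s = true
  · simp only [if_pos hg]
    have hc : ContDiff ℝ ∞ fun p : ℝ × E² => normalCutoff (δ / 5) (p.2 k - faceValue s) :=
      normalCutoff_contDiff.comp ((((EuclideanSpace.proj k : E² →L[ℝ] ℝ).contDiff).comp contDiff_snd).sub contDiff_const)
    have hW : ContDiff ℝ ∞ fun p : ℝ × E² => Wθ k p.1 ((5 : ℝ) • (p.2 - faceMidpoint k s)) :=
      (h.smooth_Wθ k).comp (contDiff_fst.prodMk ((contDiff_snd.sub contDiff_const).const_smul _))
    exact hc.mul hW
  · simp only [if_neg hg]; exact contDiff_const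

/-- The velocity blocks are smooth. [folklore] -/
theorem contDiff_cellBlockV (κ : Fin 2 → ℤ) : ContDiff ℝ ∞ (uncurry (cellBlockV Vc gate Wv δ κ)) := by
  by_cases hκ : IsInner κ
  · have e : uncurry (cellBlockV Vc gate Wv δ κ) = fun p : ℝ × E² => (5 : ℝ)⁻¹ • uncurry (Vc (toCell κ)) p := by
      funext ⟨t, z⟩; simp only [uncurry_apply_pair, cellBlockV, if_pos hκ]
    rw [e]
    exact (h.smooth_velocity (toCell κ)).const_smul _
  · have hA : ContDiff ℝ ∞ fun p : ℝ × E² => (p.1, (5 : ℝ)⁻¹ • (p.2 + latticeVec κ)) :=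
      contDiff_fst.prodMk ((contDiff_snd.add contDiff_const).const_smul _)
    have e : uncurry (cellBlockV Vc gate Wv δ κ) =
        uncurry (exteriorV gate Wv δ) ∘ fun p : ℝ × E² => (p.1, (5 : ℝ)⁻¹ • (p.2 + latticeVec κ)) := by
      funext ⟨t, z⟩; simp only [Function.comp_apply, uncurry_apply_pair, cellBlockV, if_neg hκ]
    rw [e]
    exact h.contDiff_exteriorV.comp hA

/-- The scalar blocks are smooth. [folklore] -/
theorem contDiff_cellBlockΘ (κ : Fin 2 → ℤ) : ContDiff ℝ ∞ (uncurry (cellBlockΘ Θc gate Wθ δ κ)) := by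
  by_cases hκ : IsInner κ
  · have e : uncurry (cellBlockΘ Θc gate Wθ δ κ) = uncurry (Θc (toCell κ)) := by
      funext ⟨t, z⟩; simp only [uncurry_apply_pair, cellBlockΘ, if_pos hκ]
    rw [e]
    exact h.smooth_scalar (toCell κ)
  · have hA : ContDiff ℝ ∞ fun p : ℝ × E² => (p.1, (5 : ℝ)⁻¹ • (p.2 + latticeVec κ)) :=
      contDiff_fst.prodMk ((contDiff_snd.add contDiff_const).const_smul _)
    have e : uncurry (cellBlockΘ Θc gate Wθ δ κ) =
        uncurry (exteriorΘ gate Wθ δ) ∘ fun p : ℝ × E² => (p.1, (5 : ℝ)⁻¹ • (p.2 + latticeVec κ)) := by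
      funext ⟨t, z⟩; simp only [Function.comp_apply, uncurry_apply_pair, cellBlockΘ, if_neg hκ]
    rw [e]
    exact h.contDiff_exteriorΘ.comp hA

/-- **The glued velocity is smooth on `ℝ × ℝ²`.** [cite: AlbertiCrippaMazzucato2019, §8.6] -/
theorem contDiff_cellwiseV : ContDiff ℝ ∞ (uncurry (cellwiseV Vc gate Wv δ)) :=
  contDiff_uncurry_patch_of_compatibleNear (m := 5) (ι := id) (by norm_num) h.contDiff_cellBlockV h.δ_pos
    h.patchCompatibleNear_cellBlockV

/-- **The glued scalar is smooth on `ℝ × ℝ²`.** [cite: AlbertiCrippaMazzucato2019, §8.7] -/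
theorem contDiff_cellwiseΘ : ContDiff ℝ ∞ (uncurry (cellwiseΘ Θc gate Wθ δ)) :=
  contDiff_uncurry_patch_of_compatibleNear (m := 5) (ι := id) (by norm_num) h.contDiff_cellBlockΘ h.δ_pos
    h.patchCompatibleNear_cellBlockΘ

/-- Time slices of the glued velocity are smooth. [folklore] -/
theorem contDiff_cellwiseV_slice (t : ℝ) : ContDiff ℝ ∞ (cellwiseV Vc gate Wv δ t) :=
  h.contDiff_cellwiseV.comp (contDiff_prodMk_right t)

/-- Time slices of the glued scalar are smooth. [folklore] -/
theorem contDiff_cellwiseΘ_slice (t : ℝ) : ContDiff ℝ ∞ (cellwiseΘ Θc gate Wθ δ t) :=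
  h.contDiff_cellwiseΘ.comp (contDiff_prodMk_right t)

omit h in
/-- **Cell formula for the glued velocity**: on the half-open cell `p/5 + [0,1/5)²` (lower and
left sides included) the glued velocity is `5⁻¹ • Vc p (t, 5y - p)`. [folklore] -/
theorem cellwiseV_apply_of_mem_latticeCell (p : Fin 2 → Fin 5) {y : E²} (hy : y ∈ latticeCell 5 (cidx p))
    (t : ℝ) : cellwiseV Vc gate Wv δ t y = (5 : ℝ)⁻¹ • Vc p t ((5 : ℝ) • y - latticeVec (cidx p)) := by
  unfold cellwiseV
  rw [patch_apply_of_mem_latticeCell (by norm_num) hy]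
  simp [cellBlockV, isInner_cidx p]

omit h in
/-- **Cell formula for the glued scalar**: on the half-open cell `p/5 + [0,1/5)²` the glued scalar
is `Θc p (t, 5y - p)`. [folklore] -/
theorem cellwiseΘ_apply_of_mem_latticeCell (p : Fin 2 → Fin 5) {y : E²} (hy : y ∈ latticeCell 5 (cidx p))
    (t : ℝ) : cellwiseΘ Θc gate Wθ δ t y = Θc p t ((5 : ℝ) • y - latticeVec (cidx p)) := by
  unfold cellwiseΘ
  rw [patch_apply_of_mem_latticeCell (by norm_num) hy]
  simp [cellBlockΘ, isInner_cidx p]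

omit h in
/-- On the open cell the glued scalar is the rescaled cell scalar (the form used by the
self-similarity clause). [folklore] -/
theorem cellwiseΘ_apply_of_mem_latticeCellInterior (p : Fin 2 → Fin 5) {y : E²}
    (hy : y ∈ latticeCellInterior 5 (cidx p)) (t : ℝ) :
    cellwiseΘ Θc gate Wθ δ t y = Θc p t ((5 : ℝ) • y - latticeVec (cidx p)) :=
  cellwiseΘ_apply_of_mem_latticeCell p (latticeCellInterior_subset hy) t

omit h in
/-- Outside `[0,1)²` the glued velocity is the exterior velocity. [folklore] -/
theorem cellwiseV_apply_of_not_mem {y : E²} (hy : y ∉ unitCube (Fin 2)) (t : ℝ) :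
    cellwiseV Vc gate Wv δ t y = exteriorV gate Wv δ t y := by
  unfold cellwiseV
  rw [patch_line_eq (by norm_num)]
  have hκ : ¬ IsInner (cellIndex 5 y) := fun h' => hy ((isInner_cellIndex_iff y).1 h')
  simp only [id, cellBlockV, if_neg hκ]
  congr 1
  rw [Nat.cast_ofNat, sub_add_cancel, smul_smul]; norm_num

omit h in
/-- Outside `[0,1)²` the glued scalar is the exterior scalar. [folklore] -/
theorem cellwiseΘ_apply_of_not_mem {y : E²} (hy : y ∉ unitCube (Fin 2)) (t : ℝ) :
    cellwiseΘ Θc gate Wθ δ t y = exteriorΘ gate Wθ δ t y := by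
  unfold cellwiseΘ
  rw [patch_line_eq (by norm_num)]
  have hκ : ¬ IsInner (cellIndex 5 y) := fun h' => hy ((isInner_cellIndex_iff y).1 h')
  simp only [id, cellBlockΘ, if_neg hκ]
  congr 1
  rw [Nat.cast_ofNat, sub_add_cancel, smul_smul]; norm_num

/-- **The glued fields on the strip of the face `(k, s)` of the big square**: the rescaled
window field of that face if it is a gate, zero otherwise — at all times and for all
transversal positions (inside `[0,1)²` by the outer hypotheses on the boundary cells, outside by
the construction of the exterior field). [cite: AlbertiCrippaMazzucato2019, §8.4 (b)–(c)] -/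
theorem cellwise_of_strip {k : Fin 2} {s : Bool} {y : E²} (hy : |y k - faceValue s| < δ / 5) (t : ℝ) :
    cellwiseV Vc gate Wv δ t y =
        (if gate k s = true then (5 : ℝ)⁻¹ • Wv k t ((5 : ℝ) • (y - faceMidpoint k s)) else 0) ∧
      cellwiseΘ Θc gate Wθ δ t y =
        (if gate k s = true then Wθ k t ((5 : ℝ) • (y - faceMidpoint k s)) else 0) := by
  have hδ := h.δ_pos
  have hδ4 := h.δ_le_quarter
  by_cases hin : y ∈ unitCube (Fin 2)
  swap
  · rw [cellwiseV_apply_of_not_mem hin, cellwiseΘ_apply_of_not_mem hin]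
    exact ⟨exteriorV_of_strip h.W_vanish hδ h.δ_le hy t, exteriorΘ_of_strip h.W_vanish hδ h.δ_le hy t⟩
  -- inside: the boundary cell of `y`
  set p : Fin 2 → Fin 5 := toCell (cellIndex 5 y) with hp
  have hyc : y ∈ latticeCell 5 (cidx p) := mem_latticeCell_cidx_toCell hin
  have hinner : IsInner (cellIndex 5 y) := (isInner_cellIndex_iff y).2 hin
  have hpj : ∀ j, ((p j : ℕ) : ℤ) = ⌊(5 : ℝ) * y j⌋ := fun j => by
    rw [hp, natCast_toCell hinner, cellIndex_apply]; norm_num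
  set z : E² := (5 : ℝ) • y - latticeVec (cidx p) with hz
  have hz_apply : ∀ j, z j = 5 * y j - (p j : ℕ) := fun j => by
    rw [hz, PiLp.sub_apply, PiLp.smul_apply, latticeVec_apply, cidx_apply, smul_eq_mul]; norm_cast
  have hzcube : z ∈ unitCube (Fin 2) := smul_sub_latticeVec_mem_unitCube (by norm_num) hyc
  have hzrange : ∀ i, -δ < z i ∧ z i < 1 + δ := fun i =>
    ⟨by linarith [(hzcube i).1], by linarith [(hzcube i).2]⟩
  rw [cellwiseV_apply_of_mem_latticeCell p hyc, cellwiseΘ_apply_of_mem_latticeCell p hyc, ← hz]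
  have h5y : ∀ j, ((5 : ℝ) • (y - faceMidpoint k s)) j =
      z j + (p j : ℕ) - 5 * (if j = k then faceValue s else 2⁻¹) := by
    intro j; rw [smul_sub_faceMidpoint_apply, hz_apply]; ring
  -- the transversal coordinate is far from the window unless the cell is the middle one
  have hfar : (p (k + 1) : ℕ) ≠ 2 → δ ≤ |((5 : ℝ) • (y - faceMidpoint k s)) (k + 1)| := by
    intro hne
    rw [h5y, if_neg (fin_two_succ_ne k)]
    have hin' := isInner_cidx p (k + 1)
    rw [cidx_apply] at hin'
    have hne' : ((p (k + 1) : ℕ) : ℤ) ≠ 2 := by exact_mod_cast hne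
    have := half_sub_le_abs_of_ne_two hin'.1 hin'.2 hne' (hzrange (k + 1))
    have e : z (k + 1) + ((p (k + 1) : ℕ) : ℝ) - 5 * 2⁻¹ = z (k + 1) + (((p (k + 1) : ℕ) : ℤ) : ℝ) - 5 / 2 := by
      push_cast; ring
    rw [e]; linarith
  rw [abs_lt] at hy
  cases s
  · -- lower side: `p k = 0`, `|z k| < δ`
    rw [faceValue_false] at hy
    have hpk : (p k : ℕ) = 0 := by
      have h0 : ⌊(5 : ℝ) * y k⌋ = 0 := by
        rw [Int.floor_eq_iff]; push_cast
        exact ⟨by linarith [(hin k).1], by linarith [hy.2]⟩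
      have := hpj k; rw [h0] at this; exact_mod_cast this
    have hzk : |z k| < δ := by
      rw [hz_apply, hpk, abs_lt]; push_cast
      exact ⟨by linarith [(hin k).1], by linarith [hy.2]⟩
    by_cases hg : gate k false = true
    · rw [if_pos hg, if_pos hg]
      by_cases hmid : ∀ j, j ≠ k → (p j : ℕ) = 2
      · obtain ⟨hV, hΘ⟩ := h.outer_lo_gate p k hpk hg hmid t z hzrange hzk
        have hvec : (5 : ℝ) • (y - faceMidpoint k false) = z - faceMidpoint k false := by
          ext j
          rcases fin_two_eq_or j k with hj | hj <;> rw [hj]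
          · simp only [h5y, PiLp.sub_apply, faceMidpoint_apply, hpk, faceValue_false]
            push_cast; ring
          · simp only [h5y, PiLp.sub_apply, faceMidpoint_apply, if_neg (fin_two_succ_ne k),
              hmid (k + 1) (fin_two_succ_ne k)]
            push_cast; ring
        rw [hvec, hV, hΘ]; exact ⟨rfl, rfl⟩
      · rw [fin_two_forall_ne] at hmid
        obtain ⟨hV, hΘ⟩ := h.outer_lo_vanish p k hpk (Or.inr ⟨k + 1, fin_two_succ_ne k, hmid⟩) t z hzrange hzk
        obtain ⟨hW1, hW2⟩ := h.W_vanish k t _ ⟨k + 1, fin_two_succ_ne k, hfar hmid⟩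
        rw [hV, hΘ, hW1, hW2, smul_zero]; exact ⟨rfl, rfl⟩
    · rw [if_neg hg, if_neg hg]
      obtain ⟨hV, hΘ⟩ := h.outer_lo_vanish p k hpk (Or.inl hg) t z hzrange hzk
      rw [hV, hΘ, smul_zero]; exact ⟨rfl, rfl⟩
  · -- upper side: `p k = 4`, `|z k - 1| < δ`
    rw [faceValue_true] at hy
    have hpk : (p k : ℕ) = 4 := by
      have h4 : ⌊(5 : ℝ) * y k⌋ = 4 := by
        rw [Int.floor_eq_iff]; push_cast
        exact ⟨by linarith [hy.1], by linarith [(hin k).2]⟩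
      have := hpj k; rw [h4] at this; exact_mod_cast this
    have hzk : |z k - 1| < δ := by
      rw [hz_apply, hpk, abs_lt]; push_cast
      exact ⟨by linarith [hy.1], by linarith [(hin k).2]⟩
    by_cases hg : gate k true = true
    · rw [if_pos hg, if_pos hg]
      by_cases hmid : ∀ j, j ≠ k → (p j : ℕ) = 2
      · obtain ⟨hV, hΘ⟩ := h.outer_hi_gate p k hpk hg hmid t z hzrange hzk
        have hvec : (5 : ℝ) • (y - faceMidpoint k true) = z - faceMidpoint k true := by
          ext j
          rcases fin_two_eq_or j k with hj | hj <;> rw [hj]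
          · simp only [h5y, PiLp.sub_apply, faceMidpoint_apply, hpk, faceValue_true]
            push_cast; ring
          · simp only [h5y, PiLp.sub_apply, faceMidpoint_apply, if_neg (fin_two_succ_ne k),
              hmid (k + 1) (fin_two_succ_ne k)]
            push_cast; ring
        rw [hvec, hV, hΘ]; exact ⟨rfl, rfl⟩
      · rw [fin_two_forall_ne] at hmid
        obtain ⟨hV, hΘ⟩ := h.outer_hi_vanish p k hpk (Or.inr ⟨k + 1, fin_two_succ_ne k, hmid⟩) t z hzrange hzk
        obtain ⟨hW1, hW2⟩ := h.W_vanish k t _ ⟨k + 1, fin_two_succ_ne k, hfar hmid⟩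
        rw [hV, hΘ, hW1, hW2, smul_zero]; exact ⟨rfl, rfl⟩
    · rw [if_neg hg, if_neg hg]
      obtain ⟨hV, hΘ⟩ := h.outer_hi_vanish p k hpk (Or.inl hg) t z hzrange hzk
      rw [hV, hΘ, smul_zero]; exact ⟨rfl, rfl⟩

end IsCellFamily

end Glued

/-! ## The clauses of the glued move -/

section Main

variable {S : Set ℝ} {Vc : (Fin 2 → Fin 5) → ℝ → E² → E²} {Θc : (Fin 2 → Fin 5) → ℝ → E² → ℝ}
  {gate : Fin 2 → Bool → Bool} {Wv : Fin 2 → ℝ → E² → E²} {Wθ : Fin 2 → ℝ → E² → ℝ} {δ : ℝ}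

/-- The time derivative of a slice of a jointly `C¹` function is the space–time derivative in the
time direction. [folklore] -/
theorem deriv_slice_eq_fderiv_uncurry {Φ : ℝ → E² → ℝ} (hΦ : ContDiff ℝ 1 (uncurry Φ)) (t : ℝ) (y : E²) :
    deriv (fun s => Φ s y) t = fderiv ℝ (uncurry Φ) (t, y) (1, 0) := by
  have hd : HasFDerivAt (uncurry Φ) (fderiv ℝ (uncurry Φ) (t, y)) (t, y) :=
    ((hΦ.differentiable one_ne_zero) (t, y)).hasFDerivAt
  have hl : HasDerivAt (fun s : ℝ => ((s, y) : ℝ × E²)) ((1 : ℝ), (0 : E²)) t :=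
    (hasDerivAt_id t).prodMk (hasDerivAt_const t y)
  exact (hd.comp_hasDerivAt t hl).deriv

namespace IsCellFamily

variable (h : IsCellFamily S Vc Θc gate Wv Wθ δ)
include h

/-- **Germ of the glued velocity in `[0,1)²`**: near a point of the half-open cell of `p` the
glued velocity is the rescaled cell velocity (interfaces included, by local compatibility). [folklore] -/
theorem cellwiseV_eventuallyEq {y : E²} (hy : y ∈ unitCube (Fin 2)) (t : ℝ) :
    cellwiseV Vc gate Wv δ t =ᶠ[𝓝 y] fun y' =>
      (5 : ℝ)⁻¹ • Vc (toCell (cellIndex 5 y)) t ((5 : ℝ) • y' - latticeVec (cidx (toCell (cellIndex 5 y)))) := by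
  have hin : IsInner (cellIndex 5 y) := (isInner_cellIndex_iff y).2 hy
  have hg := patch_slice_eventuallyEq (m := 5) (ι := id) (G := cellBlockV Vc gate Wv δ) (by norm_num)
    h.δ_pos h.patchCompatibleNear_cellBlockV t y
  refine hg.trans (Eventually.of_forall fun y' => ?_)
  simp only [id, cellBlockV, if_pos hin, cidx_toCell hin, Nat.cast_ofNat]

/-- **Germ of the glued scalar in `[0,1)²`.** [folklore] -/
theorem cellwiseΘ_eventuallyEq {y : E²} (hy : y ∈ unitCube (Fin 2)) (t : ℝ) :
    cellwiseΘ Θc gate Wθ δ t =ᶠ[𝓝 y] fun y' =>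
      Θc (toCell (cellIndex 5 y)) t ((5 : ℝ) • y' - latticeVec (cidx (toCell (cellIndex 5 y)))) := by
  have hin : IsInner (cellIndex 5 y) := (isInner_cellIndex_iff y).2 hy
  have hg := patch_slice_eventuallyEq (m := 5) (ι := id) (G := cellBlockΘ Θc gate Wθ δ) (by norm_num)
    h.δ_pos h.patchCompatibleNear_cellBlockΘ t y
  refine hg.trans (Eventually.of_forall fun y' => ?_)
  simp only [id, cellBlockΘ, if_pos hin, cidx_toCell hin, Nat.cast_ofNat]

/-- **Space derivative of the glued velocity in `[0,1)²`**: `D v(t)(y) w = D V_p(t)(5y - p) w`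
(the factors `5⁻¹` and `5` cancel). [folklore] -/
theorem fderiv_cellwiseV_apply {y : E²} (hy : y ∈ unitCube (Fin 2)) (t : ℝ) (w : E²) :
    fderiv ℝ (cellwiseV Vc gate Wv δ t) y w =
      fderiv ℝ (Vc (toCell (cellIndex 5 y)) t)
        ((5 : ℝ) • y - latticeVec (cidx (toCell (cellIndex 5 y)))) w := by
  set p := toCell (cellIndex 5 y)
  set c := latticeVec (cidx p)
  have hA : HasFDerivAt (fun y' : E² => (5 : ℝ) • y' - c) ((5 : ℝ) • ContinuousLinearMap.id ℝ E²) y :=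
    ((hasFDerivAt_id y).const_smul (5 : ℝ)).sub_const c
  have hVd : DifferentiableAt ℝ (Vc p t) ((5 : ℝ) • y - c) :=
    (((h.smooth_velocity p).comp (contDiff_prodMk_right t)).differentiable (by simp)).differentiableAt
  have hcomp : HasFDerivAt (fun y' : E² => Vc p t ((5 : ℝ) • y' - c))
      ((fderiv ℝ (Vc p t) ((5 : ℝ) • y - c)).comp ((5 : ℝ) • ContinuousLinearMap.id ℝ E²)) y :=
    hVd.hasFDerivAt.comp y hA
  have hF := hcomp.const_smul ((5 : ℝ)⁻¹)
  rw [(hF.congr_of_eventuallyEq (h.cellwiseV_eventuallyEq hy t)).fderiv]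
  simp [smul_smul]

/-- **Space derivative of the glued scalar in `[0,1)²`**: `D θ(t)(y) w = D Θ_p(t)(5y - p) (5 w)`. [folklore] -/
theorem fderiv_cellwiseΘ_apply {y : E²} (hy : y ∈ unitCube (Fin 2)) (t : ℝ) (w : E²) :
    fderiv ℝ (cellwiseΘ Θc gate Wθ δ t) y w =
      fderiv ℝ (Θc (toCell (cellIndex 5 y)) t)
        ((5 : ℝ) • y - latticeVec (cidx (toCell (cellIndex 5 y)))) ((5 : ℝ) • w) := by
  set p := toCell (cellIndex 5 y)
  set c := latticeVec (cidx p)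
  have hA : HasFDerivAt (fun y' : E² => (5 : ℝ) • y' - c) ((5 : ℝ) • ContinuousLinearMap.id ℝ E²) y :=
    ((hasFDerivAt_id y).const_smul (5 : ℝ)).sub_const c
  have hΘd : DifferentiableAt ℝ (Θc p t) ((5 : ℝ) • y - c) :=
    (((h.smooth_scalar p).comp (contDiff_prodMk_right t)).differentiable (by simp)).differentiableAt
  have hF : HasFDerivAt (fun y' : E² => Θc p t ((5 : ℝ) • y' - c))
      ((fderiv ℝ (Θc p t) ((5 : ℝ) • y - c)).comp ((5 : ℝ) • ContinuousLinearMap.id ℝ E²)) y :=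
    hΘd.hasFDerivAt.comp y hA
  rw [(hF.congr_of_eventuallyEq (h.cellwiseΘ_eventuallyEq hy t)).fderiv]
  simp

omit h in
/-- **Time derivative of the glued scalar in `[0,1)²`** (values along the time line are those of
the cell scalar). [folklore] -/
theorem deriv_cellwiseΘ {y : E²} (hy : y ∈ unitCube (Fin 2)) (t : ℝ) :
    deriv (fun s => cellwiseΘ Θc gate Wθ δ s y) t =
      deriv (fun s => Θc (toCell (cellIndex 5 y)) s
        ((5 : ℝ) • y - latticeVec (cidx (toCell (cellIndex 5 y))))) t := by
  have e : (fun s => cellwiseΘ Θc gate Wθ δ s y) =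
      fun s => Θc (toCell (cellIndex 5 y)) s ((5 : ℝ) • y - latticeVec (cidx (toCell (cellIndex 5 y)))) := by
    funext s
    exact cellwiseΘ_apply_of_mem_latticeCell _ (mem_latticeCell_cidx_toCell hy) s
  rw [e]

/-- **Incompressibility of the glued velocity on `S × [0,1]²`** (on `[0,1)²` it is the cell
clause at `(t, 5y - p)`; it extends to the closed square by continuity). [folklore] -/
theorem divFree_cellwise {t : ℝ} (ht : t ∈ S) {y : E²} (hy : y ∈ closedSquare) :
    ∑ j, fderiv ℝ (cellwiseV Vc gate Wv δ t) y (EuclideanSpace.single j 1) j = 0 := by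
  set D : E² → ℝ := fun y => ∑ j, fderiv ℝ (cellwiseV Vc gate Wv δ t) y (EuclideanSpace.single j 1) j with hD
  have hC1 : ContDiff ℝ 1 (cellwiseV Vc gate Wv δ t) := (h.contDiff_cellwiseV_slice t).of_le (by simp)
  have hcont : Continuous D := by
    refine continuous_finsetSum _ fun j _ => ?_
    exact (EuclideanSpace.proj j : E² →L[ℝ] ℝ).continuous.comp
      ((hC1.continuous_fderiv one_ne_zero).clm_apply continuous_const)
  have hzero : EqOn D 0 (unitCube (Fin 2)) := by
    intro y hy
    show (∑ j, fderiv ℝ (cellwiseV Vc gate Wv δ t) y (EuclideanSpace.single j 1) j) = 0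
    simp_rw [h.fderiv_cellwiseV_apply hy]
    exact h.divFree _ t ht _ (unitCube_subset_closedSquare
      (smul_sub_latticeVec_mem_unitCube (by norm_num) (mem_latticeCell_cidx_toCell hy)))
  have := hzero.closure hcont continuous_const (closedSquare_subset_closure_unitCube hy)
  simpa [hD] using this

/-- **Transport of the glued scalar on `S × [0,1]²`.** [folklore] -/
theorem transport_cellwise {t : ℝ} (ht : t ∈ S) {y : E²} (hy : y ∈ closedSquare) :
    deriv (fun s => cellwiseΘ Θc gate Wθ δ s y) t +
      fderiv ℝ (cellwiseΘ Θc gate Wθ δ t) y (cellwiseV Vc gate Wv δ t y) = 0 := by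
  set T : E² → ℝ := fun y => deriv (fun s => cellwiseΘ Θc gate Wθ δ s y) t +
    fderiv ℝ (cellwiseΘ Θc gate Wθ δ t) y (cellwiseV Vc gate Wv δ t y) with hT
  have hΘ1 : ContDiff ℝ 1 (uncurry (cellwiseΘ Θc gate Wθ δ)) := h.contDiff_cellwiseΘ.of_le (by simp)
  have hΘs1 : ContDiff ℝ 1 (cellwiseΘ Θc gate Wθ δ t) := (h.contDiff_cellwiseΘ_slice t).of_le (by simp)
  have hVs : Continuous (cellwiseV Vc gate Wv δ t) := (h.contDiff_cellwiseV_slice t).continuous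
  have hcont : Continuous T := by
    have h1 : Continuous fun y : E² => deriv (fun s => cellwiseΘ Θc gate Wθ δ s y) t := by
      have e : (fun y : E² => deriv (fun s => cellwiseΘ Θc gate Wθ δ s y) t) =
          fun y => fderiv ℝ (uncurry (cellwiseΘ Θc gate Wθ δ)) (t, y) (1, 0) := by
        funext y; exact deriv_slice_eq_fderiv_uncurry hΘ1 t y
      rw [e]
      exact ((hΘ1.continuous_fderiv one_ne_zero).comp (Continuous.prodMk_right t)).clm_apply continuous_const
    have h2 : Continuous fun y : E² => fderiv ℝ (cellwiseΘ Θc gate Wθ δ t) y (cellwiseV Vc gate Wv δ t y) :=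
      (hΘs1.continuous_fderiv one_ne_zero).clm_apply hVs
    exact h1.add h2
  have hzero : EqOn T 0 (unitCube (Fin 2)) := by
    intro y hy
    have hyc := mem_latticeCell_cidx_toCell hy
    show deriv (fun s => cellwiseΘ Θc gate Wθ δ s y) t +
      fderiv ℝ (cellwiseΘ Θc gate Wθ δ t) y (cellwiseV Vc gate Wv δ t y) = 0
    rw [deriv_cellwiseΘ hy, h.fderiv_cellwiseΘ_apply hy, cellwiseV_apply_of_mem_latticeCell _ hyc,
      smul_smul]
    norm_num
    exact h.transport _ t ht _ (unitCube_subset_closedSquare (smul_sub_latticeVec_mem_unitCube (by norm_num) hyc))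
  have := hzero.closure hcont continuous_const (closedSquare_subset_closure_unitCube hy)
  simpa [hT] using this

/-- **Bound of the glued scalar on `S × [0,1]²`.** [folklore] -/
theorem abs_cellwiseΘ_le {t : ℝ} (ht : t ∈ S) {y : E²} (hy : y ∈ closedSquare) :
    |cellwiseΘ Θc gate Wθ δ t y| ≤ 10 := by
  have hcl : IsClosed {y : E² | |cellwiseΘ Θc gate Wθ δ t y| ≤ 10} :=
    isClosed_le (continuous_abs.comp (h.contDiff_cellwiseΘ_slice t).continuous) continuous_const
  have hsub : unitCube (Fin 2) ⊆ {y : E² | |cellwiseΘ Θc gate Wθ δ t y| ≤ 10} := by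
    intro y hy
    have hyc := mem_latticeCell_cidx_toCell hy
    show |cellwiseΘ Θc gate Wθ δ t y| ≤ 10
    rw [cellwiseΘ_apply_of_mem_latticeCell _ hyc]
    exact h.abs_le _ t ht _ (unitCube_subset_closedSquare (smul_sub_latticeVec_mem_unitCube (by norm_num) hyc))
  exact closure_minimal hsub hcl (closedSquare_subset_closure_unitCube hy)

/-- **The cellwise stage is a phase of a generator move** (ACM 2019, §8.10–8.11 with §8.4
(a)–(c), §8.6): the glued fields `cellwiseV`, `cellwiseΘ` of a cell family satisfy every clause
of `QuasiSelfSimilar.IsGeneratorMoveOn` on the time set `S`, relative to the gates of the big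
square, the rescaled window fields `gateV`/`gateΘ` as gate fields, and the margin `δ/5`.
[cite: AlbertiCrippaMazzucato2019, §8.10–8.11] -/
theorem isGeneratorMoveOn :
    IsGeneratorMoveOn S (cellwiseV Vc gate Wv δ) (cellwiseΘ Θc gate Wθ δ) gate (gateV Wv) (gateΘ Wθ) (δ / 5) where
  smooth_velocity := h.contDiff_cellwiseV
  smooth_scalar := h.contDiff_cellwiseΘ
  divFree t ht y hy := h.divFree_cellwise ht hy
  tangent t _ y _ j hj := by
    rcases hj with hj | hj
    · have hs : |y j - faceValue false| < δ / 5 := by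
        rw [faceValue_false, hj, sub_zero, abs_zero]; exact div_pos h.δ_pos (by norm_num)
      rw [(h.cellwise_of_strip hs t).1]
      split_ifs
      · rw [PiLp.smul_apply, h.W_tangent j t _ (by rw [smul_sub_faceMidpoint_apply, if_pos rfl, hj, faceValue_false]; ring),
          smul_zero]
      · rfl
    · have hs : |y j - faceValue true| < δ / 5 := by
        rw [faceValue_true, hj, sub_self, abs_zero]; exact div_pos h.δ_pos (by norm_num)
      rw [(h.cellwise_of_strip hs t).1]
      split_ifs
      · rw [PiLp.smul_apply, h.W_tangent j t _ (by rw [smul_sub_faceMidpoint_apply, if_pos rfl, hj, faceValue_true]; ring),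
          smul_zero]
      · rfl
  transport t ht y hy := h.transport_cellwise ht hy
  abs_le t ht y hy := h.abs_cellwiseΘ_le ht hy
  vanish t _ y k s hs hout := by
    obtain ⟨hV, hΘ⟩ := h.cellwise_of_strip hs t
    rw [hV, hΘ]
    by_cases hg : gate k s = true
    · rw [if_pos hg, if_pos hg]
      rcases hout with hng | ⟨j, hjk, hj⟩
      · exact absurd hg hng
      · have hfar : δ ≤ |((5 : ℝ) • (y - faceMidpoint k s)) j| := by
          rw [smul_sub_faceMidpoint_apply, if_neg hjk, abs_mul, Nat.abs_ofNat]
          linarith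
        obtain ⟨h1, h2⟩ := h.W_vanish k t _ ⟨j, hjk, hfar⟩
        rw [h1, h2, smul_zero]; exact ⟨rfl, rfl⟩
    · rw [if_neg hg, if_neg hg]; exact ⟨rfl, rfl⟩
  eq_gate t _ y k s hg hs _ := by
    obtain ⟨hV, hΘ⟩ := h.cellwise_of_strip hs t
    rw [hV, hΘ, if_pos hg, if_pos hg, gateV, gateΘ, smul_sub]
    exact ⟨rfl, rfl⟩

end IsCellFamily

end Main

/-! ## Cell families from cell moves with matching windows -/

section FromMoves

/-- **A single cell move** on the unit square over the time set `S`, relative to its own gates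
`gate` and its own window fields `(Wv k s, Wθ k s)` at the four faces (ACM 2019, Fig. 11: one
fine move in one square of `𝒯_{1/5}`): the clauses of `IsGeneratorMoveOn` without tangency (the
interior interfaces are not walls), with the boundary structure required at all times and with
face-dependent window fields. [cite: AlbertiCrippaMazzucato2019, §8.10–8.11, Fig. 11] -/
structure IsCellMove (S : Set ℝ) (V : ℝ → E² → E²) (Θ : ℝ → E² → ℝ) (gate : Fin 2 → Bool → Bool)
    (Wv : Fin 2 → Bool → ℝ → E² → E²) (Wθ : Fin 2 → Bool → ℝ → E² → ℝ) (δ : ℝ) : Prop where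
  /-- `V ∈ C^∞(ℝ × ℝ²)` -/
  smooth_velocity : ContDiff ℝ ∞ (uncurry V)
  /-- `Θ ∈ C^∞(ℝ × ℝ²)` -/
  smooth_scalar : ContDiff ℝ ∞ (uncurry Θ)
  /-- incompressibility on `S × [0,1]²` -/
  divFree : ∀ t ∈ S, ∀ z ∈ closedSquare, ∑ j, fderiv ℝ (V t) z (EuclideanSpace.single j 1) j = 0
  /-- transport on `S × [0,1]²` -/
  transport : ∀ t ∈ S, ∀ z ∈ closedSquare, deriv (fun s => Θ s z) t + fderiv ℝ (Θ t) z (V t z) = 0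
  /-- bound on `S × [0,1]²` -/
  abs_le : ∀ t ∈ S, ∀ z ∈ closedSquare, |Θ t z| ≤ 10
  /-- vanishing on the face strips away from the gate windows, at all times -/
  vanish : ∀ (t : ℝ) (z : E²) (k : Fin 2) (s : Bool), |z k - faceValue s| < δ →
    (¬ gate k s = true ∨ ∃ j, j ≠ k ∧ δ ≤ |z j - 2⁻¹|) → V t z = 0 ∧ Θ t z = 0
  /-- agreement with the face's window field inside the gate windows, at all times -/
  eq_gate : ∀ (t : ℝ) (z : E²) (k : Fin 2) (s : Bool), gate k s = true → |z k - faceValue s| < δ →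
    (∀ j, j ≠ k → |z j - 2⁻¹| < 2 * δ) →
      V t z = Wv k s t (z - faceMidpoint k s) ∧ Θ t z = Wθ k s t (z - faceMidpoint k s)
  /-- the window fields vanish at transversal offset `≥ δ` -/
  W_vanish : ∀ (k : Fin 2) (s : Bool) (t : ℝ) (ζ : E²), (∃ j, j ≠ k ∧ δ ≤ |ζ j|) →
    Wv k s t ζ = 0 ∧ Wθ k s t ζ = 0

namespace IsCellMove

variable {S : Set ℝ} {V : ℝ → E² → E²} {Θ : ℝ → E² → ℝ} {gate : Fin 2 → Bool → Bool}
  {Wv : Fin 2 → Bool → ℝ → E² → E²} {Wθ : Fin 2 → Bool → ℝ → E² → ℝ} {δ : ℝ}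

/-- **A cell move on a face strip** is the window field of that face if the face is a gate and
zero otherwise, for every transversal position. [folklore] -/
theorem of_strip (h : IsCellMove S V Θ gate Wv Wθ δ) {k : Fin 2} {s : Bool} {z : E²}
    (hz : |z k - faceValue s| < δ) (t : ℝ) :
    V t z = (if gate k s = true then Wv k s t (z - faceMidpoint k s) else 0) ∧
      Θ t z = (if gate k s = true then Wθ k s t (z - faceMidpoint k s) else 0) := by
  by_cases hg : gate k s = true
  · rw [if_pos hg, if_pos hg]
    by_cases hwin : ∀ j, j ≠ k → |z j - 2⁻¹| < 2 * δ
    · exact h.eq_gate t z k s hg hz hwin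
    · rw [fin_two_forall_ne, not_lt] at hwin
      have hδz : δ ≤ |z (k + 1) - 2⁻¹| := by
        have : 0 ≤ |z (k + 1) - 2⁻¹| := abs_nonneg _
        rcases le_or_gt 0 δ with hδ | hδ <;> linarith
      obtain ⟨hV, hΘ⟩ := h.vanish t z k s hz (Or.inr ⟨k + 1, fin_two_succ_ne k, hδz⟩)
      have hfar : δ ≤ |(z - faceMidpoint k s) (k + 1)| := by
        rw [PiLp.sub_apply, faceMidpoint_apply, if_neg (fin_two_succ_ne k)]; exact hδz
      obtain ⟨hW1, hW2⟩ := h.W_vanish k s t _ ⟨k + 1, fin_two_succ_ne k, hfar⟩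
      rw [hV, hΘ, hW1, hW2]; exact ⟨rfl, rfl⟩
  · rw [if_neg hg, if_neg hg]
    exact h.vanish t z k s hz (Or.inl hg)

end IsCellMove

variable {S : Set ℝ} {Vc : (Fin 2 → Fin 5) → ℝ → E² → E²} {Θc : (Fin 2 → Fin 5) → ℝ → E² → ℝ}
  {gatec : (Fin 2 → Fin 5) → Fin 2 → Bool → Bool}
  {Wvc : (Fin 2 → Fin 5) → Fin 2 → Bool → ℝ → E² → E²} {Wθc : (Fin 2 → Fin 5) → Fin 2 → Bool → ℝ → E² → ℝ}
  {gate : Fin 2 → Bool → Bool} {Wv : Fin 2 → ℝ → E² → E²} {Wθ : Fin 2 → ℝ → E² → ℝ} {δ : ℝ}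

/-- **Cell families from cell moves with matching windows** (the form in which a design
delivers the fine stage): `25` cell moves (`IsCellMove`), each relative to its own gates and
window fields, such that
* across every interior interface the two cells have the same gate status and, if gated, the
  same window fields (as functions);
* on the outer sides, a cell is gated iff the big square is gated there and the cell is the
  middle one, and then its window fields are the universal ones `(Wv k, Wθ k)`;
* the universal window fields are smooth, tangent and transversally supported, `0 < δ ≤ 1/8`;
form a cell family. [cite: AlbertiCrippaMazzucato2019, §8.1 (e), §8.6, §8.10–8.11] -/
theorem IsCellFamily.of_moves (hδ : 0 < δ) (hδ1 : δ ≤ 8⁻¹)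
    (hmove : ∀ p, IsCellMove S (Vc p) (Θc p) (gatec p) (Wvc p) (Wθc p) δ)
    (hWv : ∀ k, ContDiff ℝ ∞ (uncurry (Wv k))) (hWθ : ∀ k, ContDiff ℝ ∞ (uncurry (Wθ k)))
    (hWtan : ∀ (k : Fin 2) (t : ℝ) (ζ : E²), ζ k = 0 → Wv k t ζ k = 0)
    (hWvan : ∀ (k : Fin 2) (t : ℝ) (ζ : E²), (∃ j, j ≠ k ∧ δ ≤ |ζ j|) → Wv k t ζ = 0 ∧ Wθ k t ζ = 0)
    (hint_gate : ∀ (p : Fin 2 → Fin 5) (k : Fin 2) (h : (p k : ℕ) + 1 < 5),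
      gatec p k true = gatec (update p k ⟨(p k : ℕ) + 1, h⟩) k false)
    (hint_W : ∀ (p : Fin 2 → Fin 5) (k : Fin 2) (h : (p k : ℕ) + 1 < 5), gatec p k true = true →
      Wvc p k true = Wvc (update p k ⟨(p k : ℕ) + 1, h⟩) k false ∧
        Wθc p k true = Wθc (update p k ⟨(p k : ℕ) + 1, h⟩) k false)
    (hlo_gate : ∀ (p : Fin 2 → Fin 5) (k : Fin 2), (p k : ℕ) = 0 →
      (gatec p k false = true ↔ (gate k false = true ∧ ∀ j, j ≠ k → (p j : ℕ) = 2)))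
    (hlo_W : ∀ (p : Fin 2 → Fin 5) (k : Fin 2), (p k : ℕ) = 0 → gatec p k false = true →
      Wvc p k false = Wv k ∧ Wθc p k false = Wθ k)
    (hhi_gate : ∀ (p : Fin 2 → Fin 5) (k : Fin 2), (p k : ℕ) = 4 →
      (gatec p k true = true ↔ (gate k true = true ∧ ∀ j, j ≠ k → (p j : ℕ) = 2)))
    (hhi_W : ∀ (p : Fin 2 → Fin 5) (k : Fin 2), (p k : ℕ) = 4 → gatec p k true = true →
      Wvc p k true = Wv k ∧ Wθc p k true = Wθ k) :
    IsCellFamily S Vc Θc gate Wv Wθ δ where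
  δ_pos := hδ
  δ_le := hδ1
  smooth_velocity p := (hmove p).smooth_velocity
  smooth_scalar p := (hmove p).smooth_scalar
  smooth_Wv := hWv
  smooth_Wθ := hWθ
  divFree p := (hmove p).divFree
  transport p := (hmove p).transport
  abs_le p := (hmove p).abs_le
  compat p k hp t z _ hk := by
    set p' := update p k ⟨(p k : ℕ) + 1, hp⟩
    -- upper cell, lower face `(k, false)`
    have hz' : |z k - faceValue false| < δ := by rwa [faceValue_false, sub_zero]
    obtain ⟨hV', hΘ'⟩ := (hmove p').of_strip hz' t
    -- lower cell, upper face `(k, true)` at `z + e_k`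
    have hz1 : |(z + EuclideanSpace.single k (1 : ℝ)) k - faceValue true| < δ := by
      rw [PiLp.add_apply, PiLp.single_apply, if_pos rfl, faceValue_true, add_sub_cancel_right]
      rwa [faceValue_false, sub_zero] at hz'
    obtain ⟨hV, hΘ⟩ := (hmove p).of_strip hz1 t
    have hmid : z + EuclideanSpace.single k (1 : ℝ) - faceMidpoint k true = z - faceMidpoint k false := by
      rw [faceMidpoint_true, ← latticeVec_single]; abel
    rw [hV', hΘ', hV, hΘ, hmid, ← hint_gate p k hp]
    by_cases hg : gatec p k true = true
    · obtain ⟨h1, h2⟩ := hint_W p k hp hg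
      rw [if_pos hg, if_pos hg, if_pos hg, if_pos hg, h1, h2]
      exact ⟨rfl, rfl⟩
    · simp only [if_neg hg, and_self]
  outer_lo_gate p k hp hg hmid t z _ hk := by
    have hz' : |z k - faceValue false| < δ := by rwa [faceValue_false, sub_zero]
    obtain ⟨hV, hΘ⟩ := (hmove p).of_strip hz' t
    have hgc : gatec p k false = true := (hlo_gate p k hp).2 ⟨hg, hmid⟩
    obtain ⟨h1, h2⟩ := hlo_W p k hp hgc
    rw [hV, hΘ, if_pos hgc, if_pos hgc, h1, h2]
    exact ⟨rfl, rfl⟩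
  outer_lo_vanish p k hp hout t z _ hk := by
    have hz' : |z k - faceValue false| < δ := by rwa [faceValue_false, sub_zero]
    obtain ⟨hV, hΘ⟩ := (hmove p).of_strip hz' t
    have hgc : ¬ gatec p k false = true := by
      intro hgc
      obtain ⟨hg, hmid⟩ := (hlo_gate p k hp).1 hgc
      rcases hout with hng | ⟨j, hjk, hj⟩
      · exact hng hg
      · exact hj (hmid j hjk)
    rw [hV, hΘ, if_neg hgc, if_neg hgc]
    exact ⟨rfl, rfl⟩
  outer_hi_gate p k hp hg hmid t z _ hk := by
    have hz' : |z k - faceValue true| < δ := by rwa [faceValue_true]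
    obtain ⟨hV, hΘ⟩ := (hmove p).of_strip hz' t
    have hgc : gatec p k true = true := (hhi_gate p k hp).2 ⟨hg, hmid⟩
    obtain ⟨h1, h2⟩ := hhi_W p k hp hgc
    rw [hV, hΘ, if_pos hgc, if_pos hgc, h1, h2]
    exact ⟨rfl, rfl⟩
  outer_hi_vanish p k hp hout t z _ hk := by
    have hz' : |z k - faceValue true| < δ := by rwa [faceValue_true]
    obtain ⟨hV, hΘ⟩ := (hmove p).of_strip hz' t
    have hgc : ¬ gatec p k true = true := by
      intro hgc
      obtain ⟨hg, hmid⟩ := (hhi_gate p k hp).1 hgc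
      rcases hout with hng | ⟨j, hjk, hj⟩
      · exact hng hg
      · exact hj (hmid j hjk)
    rw [hV, hΘ, if_neg hgc, if_neg hgc]
    exact ⟨rfl, rfl⟩
  W_tangent := hWtan
  W_vanish := hWvan

end FromMoves

/-! ## Placing a cell move in the eight orientations -/

section Placement

variable {S : Set ℝ} {V : ℝ → E² → E²} {Θ : ℝ → E² → ℝ} {gate : Fin 2 → Bool → Bool}
  {Wv : Fin 2 → Bool → ℝ → E² → E²} {Wθ : Fin 2 → Bool → ℝ → E² → ℝ} {δ : ℝ}

namespace SquareSymm

variable (τ : SquareSymm)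

/-- **The gates of a moved cell**: the face `(k, s)` of `τ • X` is the face
`(perm k, s xor flip k)` of `X`. [folklore] -/
def actGate (gate : Fin 2 → Bool → Bool) (k : Fin 2) (s : Bool) : Bool :=
  gate (τ.perm k) (xor s (τ.flip k))

/-- **The window velocities of a moved cell**: `ζ ↦ L_τ Wv_{perm k, s xor flip k}(t, L_{τ⁻¹} ζ)`. [folklore] -/
def actWv (Wv : Fin 2 → Bool → ℝ → E² → E²) (k : Fin 2) (s : Bool) (t : ℝ) (ζ : E²) : E² :=
  τ.linMap (Wv (τ.perm k) (xor s (τ.flip k)) t (τ.inv.linMap ζ))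

/-- **The window scalars of a moved cell**: `ζ ↦ Wθ_{perm k, s xor flip k}(t, L_{τ⁻¹} ζ)`. [folklore] -/
def actWθ (Wθ : Fin 2 → Bool → ℝ → E² → ℝ) (k : Fin 2) (s : Bool) (t : ℝ) (ζ : E²) : ℝ :=
  Wθ (τ.perm k) (xor s (τ.flip k)) t (τ.inv.linMap ζ)

/-- `|(L_{τ⁻¹} ζ)_{perm j}| = |ζ_j|`. [folklore] -/
theorem abs_inv_linMap_apply_perm (ζ : E²) (j : Fin 2) : |τ.inv.linMap ζ (τ.perm j)| = |ζ j| := by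
  rw [inv_linMap_apply_perm, abs_mul, abs_sgn, one_mul]

/-- **A cell move placed by a symmetry of the square is a cell move**, with the moved gates and
the moved window fields (ACM 2019, §8.1 (e): "translated, rescaled, and possibly rotated copy";
one fine-move design serves all orientations). [cite: AlbertiCrippaMazzucato2019, §8.1 (e)] -/
theorem isCellMove_act (h : IsCellMove S V Θ gate Wv Wθ δ) :
    IsCellMove S (τ.actVelocity V) (τ.actScalar Θ) (τ.actGate gate) (τ.actWv Wv) (τ.actWθ Wθ) δ where
  smooth_velocity := τ.contDiff_actVelocity h.smooth_velocity
  smooth_scalar := τ.contDiff_actScalar h.smooth_scalar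
  divFree t ht z hz := by
    have hd : DifferentiableAt ℝ (V t) (τ.inv.act z) :=
      ((h.smooth_velocity.comp (contDiff_prodMk_right t)).differentiable (by simp)).differentiableAt
    rw [τ.divergence_act hd]
    exact h.divFree t ht _ (τ.inv.act_mem_closedSquare hz)
  transport t ht z hz := by
    have hd : DifferentiableAt ℝ (Θ t) (τ.inv.act z) :=
      ((h.smooth_scalar.comp (contDiff_prodMk_right t)).differentiable (by simp)).differentiableAt
    rw [τ.transport_act hd]
    exact h.transport t ht _ (τ.inv.act_mem_closedSquare hz)
  abs_le t ht z hz := h.abs_le t ht _ (τ.inv.act_mem_closedSquare hz)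
  vanish t z k s hz hg :=
    τ.vanish_act (gate := fun k s => gate k s = true) h.vanish t z k s hz hg
  eq_gate t z k s hg hz hw := by
    have hz' : |τ.inv.act z (τ.perm k) - faceValue (xor s (τ.flip k))| < δ := by
      rw [abs_inv_act_sub_faceValue]; exact hz
    have hw' : ∀ j, j ≠ τ.perm k → |τ.inv.act z j - 2⁻¹| < 2 * δ := by
      intro j hj
      obtain ⟨i, rfl⟩ := τ.perm.surjective j
      have hik : i ≠ k := fun h' => hj (by rw [h'])
      rw [abs_inv_act_sub_half]; exact hw i hik
    obtain ⟨hV, hΘ⟩ := h.eq_gate t (τ.inv.act z) (τ.perm k) (xor s (τ.flip k)) hg hz' hw'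
    rw [inv_act_sub_faceMidpoint] at hV hΘ
    exact ⟨by rw [actVelocity_apply, hV]; rfl, by rw [actScalar_apply, hΘ]; rfl⟩
  W_vanish k s t ζ hfar := by
    obtain ⟨j, hjk, hj⟩ := hfar
    have hfar' : ∃ j', j' ≠ τ.perm k ∧ δ ≤ |τ.inv.linMap ζ j'| :=
      ⟨τ.perm j, fun h' => hjk (τ.perm.injective h'), by rw [abs_inv_linMap_apply_perm]; exact hj⟩
    obtain ⟨h1, h2⟩ := h.W_vanish (τ.perm k) (xor s (τ.flip k)) t (τ.inv.linMap ζ) hfar'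
    refine ⟨?_, h2⟩
    show τ.linMap (Wv (τ.perm k) (xor s (τ.flip k)) t (τ.inv.linMap ζ)) = 0
    rw [h1, map_zero]

end SquareSymm

end Placement

/-! ## Adding a transversal-flux-free velocity to a cell move -/

section AddVelocity

variable {S : Set ℝ} {V Z : ℝ → E² → E²} {Θ : ℝ → E² → ℝ} {gate : Fin 2 → Bool → Bool}
  {Wv Zw : Fin 2 → Bool → ℝ → E² → E²} {Wθ : Fin 2 → Bool → ℝ → E² → ℝ} {δ : ℝ}

/-- **Cell moves are stable under adding a tangential incompressible field** (the form in which
one fine-move design serves all the cells of a snake: the sliding of material through the cell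
and the flank circulation that carries area between paired cells are, cell by cell, an added
velocity `Z = ∇⊥ψ` with `ψ` a function of the across-coordinate of the channel near the channel —
so `DΘ[Z] = 0` — with its own window germs `Zw` and vanishing on the face strips away from the
windows; ACM 2019, §8.11: the moves "suitably synchronized"). Hypotheses on `Z`: smooth,
divergence free and `DΘ(t)[Z(t)] = 0` on `S × [0,1]²`, the boundary structure at all times,
and transversally supported window germs. [cite: AlbertiCrippaMazzucato2019, §8.11] -/
theorem IsCellMove.add_velocity (h : IsCellMove S V Θ gate Wv Wθ δ) (hZ : ContDiff ℝ ∞ (uncurry Z))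
    (hZdiv : ∀ t ∈ S, ∀ z ∈ closedSquare, ∑ j, fderiv ℝ (Z t) z (EuclideanSpace.single j 1) j = 0)
    (hZperp : ∀ t ∈ S, ∀ z ∈ closedSquare, fderiv ℝ (Θ t) z (Z t z) = 0)
    (hZvan : ∀ (t : ℝ) (z : E²) (k : Fin 2) (s : Bool), |z k - faceValue s| < δ →
      (¬ gate k s = true ∨ ∃ j, j ≠ k ∧ δ ≤ |z j - 2⁻¹|) → Z t z = 0)
    (hZwin : ∀ (t : ℝ) (z : E²) (k : Fin 2) (s : Bool), gate k s = true → |z k - faceValue s| < δ →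
      (∀ j, j ≠ k → |z j - 2⁻¹| < 2 * δ) → Z t z = Zw k s t (z - faceMidpoint k s))
    (hZw : ∀ (k : Fin 2) (s : Bool) (t : ℝ) (ζ : E²), (∃ j, j ≠ k ∧ δ ≤ |ζ j|) → Zw k s t ζ = 0) :
    IsCellMove S (fun t z => V t z + Z t z) Θ gate (fun k s t ζ => Wv k s t ζ + Zw k s t ζ) Wθ δ where
  smooth_velocity := h.smooth_velocity.add hZ
  smooth_scalar := h.smooth_scalar
  divFree t ht z hz := by
    have hV : DifferentiableAt ℝ (V t) z :=
      ((h.smooth_velocity.comp (contDiff_prodMk_right t)).differentiable (by simp)).differentiableAt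
    have hZ' : DifferentiableAt ℝ (Z t) z :=
      ((hZ.comp (contDiff_prodMk_right t)).differentiable (by simp)).differentiableAt
    have e : (fun z => V t z + Z t z) = V t + Z t := rfl
    rw [e]
    simp_rw [fderiv_add hV hZ', FunLike.coe_add, Pi.add_apply, PiLp.add_apply, Finset.sum_add_distrib]
    rw [h.divFree t ht z hz, hZdiv t ht z hz, add_zero]
  transport t ht z hz := by
    rw [map_add, hZperp t ht z hz, add_zero]
    exact h.transport t ht z hz
  abs_le := h.abs_le
  vanish t z k s hz hg := by
    obtain ⟨hV, hΘ⟩ := h.vanish t z k s hz hg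
    refine ⟨?_, hΘ⟩
    show V t z + Z t z = 0
    rw [hV, hZvan t z k s hz hg, add_zero]
  eq_gate t z k s hg hz hw := by
    obtain ⟨hV, hΘ⟩ := h.eq_gate t z k s hg hz hw
    refine ⟨?_, hΘ⟩
    show V t z + Z t z = _
    rw [hV, hZwin t z k s hg hz hw]
  W_vanish k s t ζ hfar := by
    obtain ⟨h1, h2⟩ := h.W_vanish k s t ζ hfar
    refine ⟨?_, h2⟩
    show Wv k s t ζ + Zw k s t ζ = 0
    rw [h1, hZw k s t ζ hfar, add_zero]

end AddVelocity

end QuasiSelfSimilar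

end Literature.Analysis.FluidPDE
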